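import Mathlib.Analysis.Complex.Harmonic.Analytic
import Mathlib.Analysis.Complex.BorelCaratheodory
import Mathlib.Analysis.Complex.RemovableSingularity
import Mathlib.Analysis.Complex.Liouville
import Literature.Analysis.FluidPDE.GeneralizedAxisymNS
import HarnessLib

/-!
# The two analysis engines of Chae–Tsai's Theorem 2 (generalized Luo–Hou ansatz):
# the maximum principle on the closed half-plane, and the affine rigidity of a stream profile
# with constant Laplacian, wall condition and sub-linear gradient

Analysis/FluidPDE proof file (theorems only: no definitions, no named facts, no `sorry`), first of
the two files typing **Theorem 2** of D. Chae, T.-P. Tsai, *Remark on Luo–Hou's ansatz for a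
self-similar solution to the 3D Euler equations*, J. Nonlinear Sci. **25** (2015) 193–202 =
arXiv:1402.4560 [`ChaeTsai2015`], §3 (arXiv p. 5–6). The theorem itself (the generalized
multi-order ansatz `u₁ = (T−t)^{−1+γ/2} Σ_k (T−t)^{kγ} U_k(R,Z)`, … with the wall condition
`∂_ZΨ_k|_{R=0} = 0` is trivial) is assembled in `LuoHouSeriesAnsatz.lean`; this file proves, in
the meridian-profile vocabulary `derivR`/`derivZ` of `GeneralizedAxisymNS`, the two arguments
its inductive proof runs on at every order `k`:

* **Engine A — the maximum principle on the CLOSED half-plane `𝒟̄ = {R ≤ 0}`**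
  (`eq_zero_of_transport_wall_maxPrinciple`; print, p. 5: "Suppose `sup U₀ > 0`. Since
  `U₀(Y) = o(1)` […] the maximum of `U₀` is attained at some point `Y₀`. If `Y₀` is in the
  interior, then (28) implies `U₀(Y₀) = 0` […]. Thus `Y₀` lies on the `Z`-axis. At `Y₀ = (0, Z₀)`
  we have `∇⊥Ψ₀ = (0, ∂_RΨ₀)` by assumption (Psi-BC), and `∂_ZU₀ = 0` since `Y₀` is a maximum
  point. […] We get `(1 − γ/2)U₀(Y₀) = 0`"): a `C¹` function `U` on an open neighbourhood of `𝒟̄`,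
  decaying at infinity in `𝒟̄`, with `cU + γY·∇U + W·∇U = 0` on the open half-plane, `c ≠ 0`,
  `W` continuous with normal component `W₁ = 0` on the wall, vanishes on `𝒟̄`. Its companion for
  the resonant orders, **Engine A′** (`eq_zero_of_rayTransport`): `R∂_RU + (Z − z₀)∂_ZU = 0` on
  the open half-plane ⇒ `U ≡ 0` on `𝒟̄` (constancy along the rays from the wall point `(0, z₀)`,
  which stay in `𝒟̄` and escape to infinity; print's case `γ = 2` of Thm. 1, "`U(Z) =` constant
  `= 0` for `Z ≠ 0`. By continuity `U|_{Z=0} = 0` also", one dimension up).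
* **Engine B — the stream step** (`stream_affine_of_wall_of_sublinearGradient`; print, p. 5:
  "By `Ψ₀`-equation (30), `Ψ₀` and `∇Ψ₀` are harmonic. By the boundary conditions (UOPsi-infty)
  and (Psi-BC), we get `∂_ZΨ₀ = 0`. Thus `Ψ₀ = Ψ₀(R)` […] `Ψ₀ = aR + b`"): a `C²` function `Ψ` on
  an open neighbourhood of `𝒟̄` with `∂_ZΨ = 0` on the wall, `ΔΨ = κ` (a constant) on the open
  half-plane and `|∇Ψ(Y)| = o(|Y|)` on `𝒟̄` satisfies `κ = 0` AND `Ψ = aR + b` on `𝒟̄`. (The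
  constant `κ` is carried because at order `k ≥ 1` the stream equation (21k) has the source
  `−3∂_RΨ_{k−1}`; `κ = 0` is what makes the previous slope vanish — print's sentence "By
  (UOPsi-infty), `a = 0`" does not follow from `|∇Ψ₀| = o(|Y|)`, a constant gradient being
  `o(|Y|)`; see the docstring of `chaeTsai2015_seriesAnsatz_trivial`.)

## Method of Engine B (textbook provenance)

The wall condition makes `Ψ(0, ·)` constant; subtracting it and `(κ/2)R²` gives `Φ ∈ C²` near
`𝒟̄`, harmonic on `𝒟̄`, `Φ = 0` on the wall, `|Φ(Y)| ≤ C(1 + |Y|²)` (mean value inequality,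
Mathlib `Convex.norm_image_sub_le_of_norm_fderiv_le`). Its ODD REFLECTION across the wall is
`C²` and harmonic on the plane — the Schwarz reflection principle for harmonic functions
vanishing on a hyperplane, in the elementary case of a function `C²` up to the wall (there
`Φ = ΔΦ = 0` on the wall force `∂_Zφ = ∂_ZZΦ = ∂_RRΦ = 0`, so the two pieces glue to second order;
`oddReflection_C2_harmonic`, through a `C¹` gluing lemma `glue_C1` resting on an "either"-lemma
for `HasFDerivAt`). Transported to `ℂ` it is harmonic in Mathlib's sense
(`InnerProductSpace.HarmonicOnNhd`, `InnerProductSpace.laplacian_eq_iteratedFDeriv_complexPlane`),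
hence the real part of an entire function (`HarmonicOnNhd.exists_analyticOnNhd_univ_re_eq`),
which has quadratic growth by the Borel–Carathéodory inequality (`Complex.borelCaratheodory`) and
is therefore a quadratic polynomial (Liouville, `Differentiable.apply_eq_apply_of_bounded`,
applied to the second difference quotient `dslope (dslope F 0) 0`). So
`Φ = Re(αz² + βz + c)`; the wall kills `Re α`, `Im β`, `Re c`, and the growth of `∇Ψ` kills `Im α`
and `κ`.

## Rendering (never stronger than print as a hypothesis set without saying so)

Profiles are functions `ℝ × ℝ → ℝ` of `Y = (R, Z)`; "`C¹_loc(𝒟̄)`" of print is rendered as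
`ContDiffOn` on an open set `O ⊇ {R ≤ 0}` (`C²` for the stream profile, whose Laplacian print
uses classically); decay "`= o(1)`" as `∀ ε > 0, ∃ M, ∀ Y ∈ 𝒟̄, M ≤ ‖Y‖ → |U Y| < ε`, and
"`|∇Ψ(Y)| = o(|Y|)`" as `… → |∂_RΨ Y| + |∂_ZΨ Y| ≤ ε‖Y‖` (`‖·‖` the sup norm of `ℝ × ℝ`); the
equations hold pointwise on the OPEN half-plane `{R < 0}` (where the Euler equations deliver
them) and are extended to the wall by continuity inside the proofs.

## What this is NOT

Not a statement about Navier–Stokes, nor about Luo–Hou's or anyone's computation: two lemmas of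
real analysis about hypothetical profile functions on a half-plane. Nothing here asserts or denies
blow-up.

## Mathlib / tree search

`lean search 'HarmonicAt|HarmonicOnNhd|iouville.*harmonic|reflection'` (2026-08-27): Mathlib has
harmonic functions on inner-product spaces (`InnerProductSpace.HarmonicAt`), the plane Liouville
theorem for BOUNDED harmonic functions (`InnerProductSpace.bounded_harmonic_on_complex_plane_is_constant`),
Borel–Carathéodory, `dslope`/removable singularities; no reflection principle, no half-plane
Phragmén–Lindelöf for harmonic functions, no polynomial-growth Liouville — proved here in the
special forms needed. Tree: `derivR`, `derivZ`, `fderiv_apply_eq_derivR_derivZ`, `derivR_slice`,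
`derivR_derivR_slice`, … (`GeneralizedAxisymNS.lean`), `Calculus.fderiv_fderiv_apply_const`
(`DivCurlPlane.lean`).

## References

* D. Chae, T.-P. Tsai, J. Nonlinear Sci. 25 (2015) 193–202, doi:10.1007/s00332-014-9225-6,
  arXiv:1402.4560: §3, Theorem 2 and its proof (arXiv p. 5–6). [ChaeTsai2015]
* T. Y. Hou, arXiv:2405.10916, §2 (the `(u₁, ω₁, ψ₁)` variables = `GeneralizedAxisymNS`). [Hou2026]
-/

noncomputable section

open Set Function Filter
open scoped Topology ContDiff

namespace Literature.Analysis.FluidPDE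

namespace LuoHouSeries

/-! ### Generic lemma 2: gluing across a point ("either" lemmas) -/

section Either

variable {E F : Type*} [NormedAddCommGroup E] [NormedSpace ℝ E] [NormedAddCommGroup F]
  [NormedSpace ℝ F]

/-- If `g` coincides at every point with one of two functions `f₁`, `f₂` which agree at `x` and
have the same derivative `L` at `x`, then `g` has derivative `L` at `x`. [folklore] -/
private theorem hasFDerivAt_of_either {f₁ f₂ g : E → F} {L : E →L[ℝ] F} {x : E}
    (h₁ : HasFDerivAt f₁ L x) (h₂ : HasFDerivAt f₂ L x) (hx₁ : g x = f₁ x) (hx₂ : g x = f₂ x)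
    (hg : ∀ y, g y = f₁ y ∨ g y = f₂ y) : HasFDerivAt g L x := by
  rw [hasFDerivAt_iff_isLittleO_nhds_zero] at h₁ h₂ ⊢
  refine Asymptotics.IsLittleO.of_isBigOWith fun c hc => ?_
  have h₁' := (h₁.forall_isBigOWith (half_pos hc))
  have h₂' := (h₂.forall_isBigOWith (half_pos hc))
  rw [Asymptotics.isBigOWith_iff] at h₁' h₂' ⊢
  filter_upwards [h₁', h₂'] with v hv₁ hv₂
  rcases hg (x + v) with e | e
  · rw [e, hx₁]
    exact hv₁.trans (by nlinarith [norm_nonneg v])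
  · rw [e, hx₂]
    exact hv₂.trans (by nlinarith [norm_nonneg v])

omit [NormedSpace ℝ E] [NormedSpace ℝ F] in
/-- If `g` coincides at every point with one of two functions continuous at `x` which agree with
`g` at `x`, then `g` is continuous at `x`. [folklore] -/
private theorem continuousAt_of_either {f₁ f₂ g : E → F} {x : E}
    (h₁ : ContinuousAt f₁ x) (h₂ : ContinuousAt f₂ x) (hx₁ : g x = f₁ x) (hx₂ : g x = f₂ x)
    (hg : ∀ y, g y = f₁ y ∨ g y = f₂ y) : ContinuousAt g x := by
  rw [ContinuousAt, Metric.tendsto_nhds] at h₁ h₂ ⊢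
  intro ε hε
  filter_upwards [h₁ ε hε, h₂ ε hε] with y hy₁ hy₂
  rcases hg y with e | e
  · rw [e, hx₁]; exact hy₁
  · rw [e, hx₂]; exact hy₂

end Either

/-! ### Generic lemma 3: entire functions of quadratic growth (Liouville) -/

section ComplexLiouville

/-- An entire function of at most linear growth outside the unit ball whose difference quotient
at `0` is considered: `dslope F 0` is entire. [folklore] -/
private theorem differentiable_dslope {F : ℂ → ℂ} (hF : Differentiable ℂ F) :
    Differentiable ℂ (dslope F 0) := by
  have h := (Complex.differentiableOn_dslope (f := F) (c := (0 : ℂ)) (s := univ) univ_mem).2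
    hF.differentiableOn
  exact differentiableOn_univ.1 h

/-- Growth transfer to the difference quotient: if `‖F z‖ ≤ A + B ‖z‖^(n+1)`-type bounds hold,
here in the concrete form needed. For `z ≠ 0`, `‖dslope F 0 z‖ ≤ (‖F z‖ + ‖F 0‖)/‖z‖`.
[folklore] -/
private theorem norm_dslope_le {F : ℂ → ℂ} {z : ℂ} (hz : z ≠ 0) :
    ‖dslope F 0 z‖ ≤ (‖F z‖ + ‖F 0‖) / ‖z‖ := by
  rw [dslope_of_ne F hz, slope_def_module, sub_zero, norm_smul, norm_inv]
  rw [div_eq_inv_mul]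
  gcongr
  exact norm_sub_le _ _

/-- A continuous function on `ℂ` bounded outside the closed unit ball is bounded. [folklore] -/
private theorem exists_bound_of_bound_outside {G : ℂ → ℂ} (hG : Continuous G) {B : ℝ}
    (hB : ∀ z : ℂ, 1 ≤ ‖z‖ → ‖G z‖ ≤ B) : ∃ C, ∀ z, ‖G z‖ ≤ C := by
  obtain ⟨C₀, hC₀⟩ := (isCompact_closedBall (0 : ℂ) 1).exists_bound_of_continuousOn
    hG.continuousOn
  refine ⟨max C₀ B, fun z => ?_⟩
  by_cases hz : ‖z‖ ≤ 1
  · exact (hC₀ z (mem_closedBall_zero_iff.2 hz)).trans (le_max_left _ _)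
  · exact (hB z (not_le.1 hz).le).trans (le_max_right _ _)

/-- **Entire functions of quadratic growth are quadratic polynomials** (Liouville applied to the
second difference quotient). [folklore] -/
private theorem exists_eq_quadratic_of_growth {F : ℂ → ℂ} (hF : Differentiable ℂ F) {C : ℝ}
    (hC : ∀ z, ‖F z‖ ≤ C * (1 + ‖z‖ ^ 2)) :
    ∃ α β c : ℂ, ∀ z, F z = α * z ^ 2 + β * z + c := by
  have hC0 : 0 ≤ C := by
    have := hC 0
    have h0 : (0 : ℝ) ≤ ‖F 0‖ := norm_nonneg _
    nlinarith [norm_nonneg (F 0)]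
  -- first difference quotient: linear growth
  set G₁ := dslope F 0 with hG₁
  have hG₁d : Differentiable ℂ G₁ := differentiable_dslope hF
  have hG₁b : ∀ z : ℂ, 1 ≤ ‖z‖ → ‖G₁ z‖ ≤ (2 * C + ‖F 0‖) * ‖z‖ := by
    intro z hz
    have hz0 : z ≠ 0 := by
      intro e; rw [e, norm_zero] at hz; exact absurd hz (by norm_num)
    have hzpos : 0 < ‖z‖ := norm_pos_iff.2 hz0
    calc ‖G₁ z‖ ≤ (‖F z‖ + ‖F 0‖) / ‖z‖ := norm_dslope_le hz0
      _ ≤ (C * (1 + ‖z‖ ^ 2) + ‖F 0‖) / ‖z‖ := by gcongr; exact hC z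
      _ ≤ (2 * C + ‖F 0‖) * ‖z‖ := by
          rw [div_le_iff₀ hzpos]
          have h1 : C * 1 ≤ C * ‖z‖ ^ 2 := by
            apply mul_le_mul_of_nonneg_left _ hC0; nlinarith
          have h2 : ‖F 0‖ ≤ ‖F 0‖ * (‖z‖ * ‖z‖) := by
            have : (1 : ℝ) ≤ ‖z‖ * ‖z‖ := by nlinarith
            nlinarith [norm_nonneg (F 0)]
          nlinarith
  -- second difference quotient: bounded
  set G₂ := dslope G₁ 0 with hG₂
  have hG₂d : Differentiable ℂ G₂ := differentiable_dslope hG₁d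
  have hG₂b : ∀ z : ℂ, 1 ≤ ‖z‖ → ‖G₂ z‖ ≤ 2 * C + ‖F 0‖ + ‖G₁ 0‖ := by
    intro z hz
    have hz0 : z ≠ 0 := by
      intro e; rw [e, norm_zero] at hz; exact absurd hz (by norm_num)
    have hzpos : 0 < ‖z‖ := norm_pos_iff.2 hz0
    calc ‖G₂ z‖ ≤ (‖G₁ z‖ + ‖G₁ 0‖) / ‖z‖ := norm_dslope_le hz0
      _ ≤ ((2 * C + ‖F 0‖) * ‖z‖ + ‖G₁ 0‖ * ‖z‖) / ‖z‖ := by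
          gcongr
          · exact hG₁b z hz
          · nlinarith [norm_nonneg (G₁ 0)]
      _ = 2 * C + ‖F 0‖ + ‖G₁ 0‖ := by field_simp
  obtain ⟨B, hB⟩ := exists_bound_of_bound_outside hG₂d.continuous hG₂b
  have hconst : ∀ z w, G₂ z = G₂ w :=
    fun z w => hG₂d.apply_eq_apply_of_bounded (isBounded_iff_forall_norm_le.2
      ⟨B, by rintro _ ⟨z, rfl⟩; exact hB z⟩) z w
  refine ⟨G₂ 0, G₁ 0, F 0, fun z => ?_⟩
  have e1 : F z = F 0 + z * G₁ z := by
    have := sub_smul_dslope F 0 z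
    rw [sub_zero, smul_eq_mul] at this
    rw [hG₁]; linear_combination -this
  have e2 : G₁ z = G₁ 0 + z * G₂ z := by
    have := sub_smul_dslope G₁ 0 z
    rw [sub_zero, smul_eq_mul] at this
    rw [hG₂]; linear_combination -this
  rw [e1, e2, hconst z 0]; ring

/-- **Borel–Carathéodory, quadratic-growth form.** If the real part of an entire function is
bounded above by `C(1 + ‖z‖²)`, the function itself has quadratic growth. [folklore] -/
private theorem norm_le_of_re_le_quadratic {F : ℂ → ℂ} (hF : Differentiable ℂ F) {C : ℝ}
    (hC0 : 0 < C) (hC : ∀ z, (F z).re ≤ C * (1 + ‖z‖ ^ 2)) :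
    ∀ z, ‖F z‖ ≤ (2 * C * 9 + 3 * ‖F 0‖) * (1 + ‖z‖ ^ 2) := by
  intro z
  set R : ℝ := 2 * (‖z‖ + 1) with hR
  have hz0 : 0 ≤ ‖z‖ := norm_nonneg z
  have hRpos : 0 < R := by rw [hR]; positivity
  have hzR : z ∈ Metric.ball (0 : ℂ) R := by
    rw [Metric.mem_ball, dist_zero_right, hR]; linarith
  set M : ℝ := C * (1 + R ^ 2) with hM
  have hMpos : 0 < M := by rw [hM]; positivity
  have hmaps : MapsTo F (Metric.ball (0 : ℂ) R) {w | w.re ≤ M} := by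
    intro w hw
    rw [Metric.mem_ball, dist_zero_right] at hw
    show (F w).re ≤ M
    refine (hC w).trans ?_
    rw [hM]
    apply mul_le_mul_of_nonneg_left _ hC0.le
    nlinarith [norm_nonneg w]
  have hBC := Complex.borelCaratheodory hMpos hF.differentiableOn hmaps hRpos hzR
  have hden : R - ‖z‖ = ‖z‖ + 2 := by rw [hR]; ring
  rw [hden] at hBC
  have hd0 : 0 < ‖z‖ + 2 := by positivity
  have t1 : 2 * M * ‖z‖ / (‖z‖ + 2) ≤ 2 * M := by
    rw [div_le_iff₀ hd0]; nlinarith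
  have t2 : ‖F 0‖ * (R + ‖z‖) / (‖z‖ + 2) ≤ 3 * ‖F 0‖ := by
    rw [div_le_iff₀ hd0, hR]; nlinarith [norm_nonneg (F 0)]
  have hM' : M ≤ C * 9 * (1 + ‖z‖ ^ 2) := by
    rw [hM, hR]
    have : 1 + (2 * (‖z‖ + 1)) ^ 2 ≤ 9 * (1 + ‖z‖ ^ 2) := by
      nlinarith [sq_nonneg (‖z‖ - 1)]
    nlinarith
  calc ‖F z‖ ≤ 2 * M * ‖z‖ / (‖z‖ + 2) + ‖F 0‖ * (R + ‖z‖) / (‖z‖ + 2) := hBC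
    _ ≤ 2 * M + 3 * ‖F 0‖ := add_le_add t1 t2
    _ ≤ (2 * C * 9 + 3 * ‖F 0‖) * (1 + ‖z‖ ^ 2) := by nlinarith [norm_nonneg (F 0)]

/-- **Harmonic functions of quadratic growth on the plane are quadratic harmonic polynomials**:
`f = Re(α z² + β z + c)`. [folklore] -/
private theorem harmonic_quadratic_growth {f : ℂ → ℝ}
    (hf : InnerProductSpace.HarmonicOnNhd f univ) {C : ℝ} (hC0 : 0 < C)
    (hC : ∀ z, |f z| ≤ C * (1 + ‖z‖ ^ 2)) :
    ∃ α β c : ℂ, ∀ z, f z = (α * z ^ 2 + β * z + c).re := by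
  obtain ⟨F, hFa, hFre⟩ := hf.exists_analyticOnNhd_univ_re_eq
  have hFd : Differentiable ℂ F := fun z => (hFa z (mem_univ z)).differentiableAt
  have hre : ∀ z, (F z).re ≤ C * (1 + ‖z‖ ^ 2) := fun z => by
    have h : (F z).re = f z := congrFun hFre z
    rw [h]
    exact (le_abs_self _).trans (hC z)
  obtain ⟨α, β, c, hq⟩ := exists_eq_quadratic_of_growth hFd
    (norm_le_of_re_le_quadratic hFd hC0 hre)
  refine ⟨α, β, c, fun z => ?_⟩
  rw [← hq z]
  exact (congrFun hFre z).symm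

end ComplexLiouville

/-! ### Calculus on an open neighbourhood of the closed half-plane `𝒟̄ = {R ≤ 0}` -/

section HalfPlaneCalculus

variable {O : Set (ℝ × ℝ)} {G h : ℝ × ℝ → ℝ} {n : WithTop ℕ∞}

/-- Differentiability at points of an open set carrying a `Cⁿ` function, `n ≠ 0`. [folklore] -/
private theorem differentiableAt_of_contDiffOn_open (hG : ContDiffOn ℝ n G O) (hO : IsOpen O)
    (hn : n ≠ 0) {Y : ℝ × ℝ} (hY : Y ∈ O) : DifferentiableAt ℝ G Y :=
  (hG.differentiableOn hn).differentiableAt (hO.mem_nhds hY)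

/-- `∂_R` of a `C²` function is `C¹` on the open set. [folklore] -/
private theorem contDiffOn_derivR_open (hG : ContDiffOn ℝ 2 G O) (hO : IsOpen O) :
    ContDiffOn ℝ 1 (derivR G) O := by
  have h : ContDiffOn ℝ 1 (fderiv ℝ G) O := hG.fderiv_of_isOpen hO le_rfl
  have e : derivR G = fun q => fderiv ℝ G q (1, 0) := funext fun q => derivR_apply G q
  rw [e]
  exact h.clm_apply contDiffOn_const

/-- `∂_Z` of a `C²` function is `C¹` on the open set. [folklore] -/
private theorem contDiffOn_derivZ_open (hG : ContDiffOn ℝ 2 G O) (hO : IsOpen O) :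
    ContDiffOn ℝ 1 (derivZ G) O := by
  have h : ContDiffOn ℝ 1 (fderiv ℝ G) O := hG.fderiv_of_isOpen hO le_rfl
  have e : derivZ G = fun q => fderiv ℝ G q (0, 1) := funext fun q => derivZ_apply G q
  rw [e]
  exact h.clm_apply contDiffOn_const

/-- `∂_R` of a `C¹` function is continuous on the open set. [folklore] -/
private theorem continuousOn_derivR_open (hG : ContDiffOn ℝ 1 G O) (hO : IsOpen O) :
    ContinuousOn (derivR G) O := by
  have h : ContinuousOn (fderiv ℝ G) O := hG.continuousOn_fderiv_of_isOpen hO le_rfl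
  have e : derivR G = fun q => fderiv ℝ G q (1, 0) := funext fun q => derivR_apply G q
  rw [e]
  exact h.clm_apply continuousOn_const

/-- `∂_Z` of a `C¹` function is continuous on the open set. [folklore] -/
private theorem continuousOn_derivZ_open (hG : ContDiffOn ℝ 1 G O) (hO : IsOpen O) :
    ContinuousOn (derivZ G) O := by
  have h : ContinuousOn (fderiv ℝ G) O := hG.continuousOn_fderiv_of_isOpen hO le_rfl
  have e : derivZ G = fun q => fderiv ℝ G q (0, 1) := funext fun q => derivZ_apply G q
  rw [e]
  exact h.clm_apply continuousOn_const

/-- The slice `r ↦ G (r, Z)` has derivative `∂_R G` where `G` is differentiable. [folklore] -/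
private theorem hasDerivAt_sliceR_pt {Y : ℝ × ℝ} (hG : DifferentiableAt ℝ G Y) :
    HasDerivAt (fun r => G (r, Y.2)) (derivR G Y) Y.1 := by
  have hd : DifferentiableAt ℝ (fun r : ℝ => G (r, Y.2)) Y.1 := by
    have : DifferentiableAt ℝ (fun r : ℝ => ((r, Y.2) : ℝ × ℝ)) Y.1 :=
      differentiableAt_id.prodMk (differentiableAt_const _)
    exact DifferentiableAt.comp (Y.1) (by simpa using hG) this
  rw [derivR_eq_deriv hG]
  exact hd.hasDerivAt

/-- The slice `z ↦ G (R, z)` has derivative `∂_Z G` where `G` is differentiable. [folklore] -/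
private theorem hasDerivAt_sliceZ_pt {Y : ℝ × ℝ} (hG : DifferentiableAt ℝ G Y) :
    HasDerivAt (fun z => G (Y.1, z)) (derivZ G Y) Y.2 := by
  have hd : DifferentiableAt ℝ (fun z : ℝ => G (Y.1, z)) Y.2 := by
    have : DifferentiableAt ℝ (fun z : ℝ => ((Y.1, z) : ℝ × ℝ)) Y.2 :=
      (differentiableAt_const _).prodMk differentiableAt_id
    exact DifferentiableAt.comp (Y.2) (by simpa using hG) this
  rw [derivZ_eq_deriv hG]
  exact hd.hasDerivAt

/-- `∂_R (G + h) = ∂_R G + ∂_R h` at points of differentiability. [folklore] -/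
private theorem derivR_add_pt {Y : ℝ × ℝ} (hG : DifferentiableAt ℝ G Y) (hh : DifferentiableAt ℝ h Y) :
    derivR (fun q => G q + h q) Y = derivR G Y + derivR h Y := by
  rw [derivR_apply, derivR_apply, derivR_apply, fderiv_fun_add hG hh]; rfl

/-- `∂_Z (G + h) = ∂_Z G + ∂_Z h` at points of differentiability. [folklore] -/
private theorem derivZ_add_pt {Y : ℝ × ℝ} (hG : DifferentiableAt ℝ G Y) (hh : DifferentiableAt ℝ h Y) :
    derivZ (fun q => G q + h q) Y = derivZ G Y + derivZ h Y := by
  rw [derivZ_apply, derivZ_apply, derivZ_apply, fderiv_fun_add hG hh]; rfl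

/-- `∂_R (−G) = −∂_R G` (unconditionally, by the junk-value conventions). [folklore] -/
private theorem derivR_fun_neg (G : ℝ × ℝ → ℝ) (Y : ℝ × ℝ) :
    derivR (fun q => -G q) Y = -derivR G Y := by
  rw [derivR_apply, derivR_apply, fderiv_fun_neg]; rfl

/-- `∂_Z (−G) = −∂_Z G`. [folklore] -/
private theorem derivZ_fun_neg (G : ℝ × ℝ → ℝ) (Y : ℝ × ℝ) :
    derivZ (fun q => -G q) Y = -derivZ G Y := by
  rw [derivZ_apply, derivZ_apply, fderiv_fun_neg]; rfl

/-- The reflection `(R, Z) ↦ (−R, Z)` across the wall has derivative itself. [folklore] -/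
private theorem hasFDerivAt_reflect (Y : ℝ × ℝ) :
    HasFDerivAt (fun q : ℝ × ℝ => ((-q.1, q.2) : ℝ × ℝ))
      ((-ContinuousLinearMap.fst ℝ ℝ ℝ).prod (ContinuousLinearMap.snd ℝ ℝ ℝ)) Y :=
  (hasFDerivAt_fst.neg).prodMk hasFDerivAt_snd

/-- The reflection across the wall is smooth. [folklore] -/
private theorem contDiff_reflect : ContDiff ℝ ∞ fun q : ℝ × ℝ => ((-q.1, q.2) : ℝ × ℝ) :=
  (contDiff_fst.neg).prodMk contDiff_snd

/-- Chain rule through the reflection: `∂_R [G(−R, Z)] = −(∂_R G)(−R, Z)`. [folklore] -/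
private theorem derivR_comp_reflect {Y : ℝ × ℝ} (hG : DifferentiableAt ℝ G (-Y.1, Y.2)) :
    derivR (fun q => G (-q.1, q.2)) Y = -derivR G (-Y.1, Y.2) := by
  have h : HasFDerivAt (fun q : ℝ × ℝ => G (-q.1, q.2))
      ((fderiv ℝ G (-Y.1, Y.2)).comp
        ((-ContinuousLinearMap.fst ℝ ℝ ℝ).prod (ContinuousLinearMap.snd ℝ ℝ ℝ))) Y :=
    hG.hasFDerivAt.comp Y (hasFDerivAt_reflect Y)
  rw [derivR_apply, h.fderiv, ContinuousLinearMap.comp_apply]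
  simp only [ContinuousLinearMap.prod_apply, FunLike.coe_neg, Pi.neg_apply,
    ContinuousLinearMap.coe_fst', ContinuousLinearMap.coe_snd']
  rw [fderiv_apply_eq_derivR_derivZ]; ring

/-- Chain rule through the reflection: `∂_Z [G(−R, Z)] = (∂_Z G)(−R, Z)`. [folklore] -/
private theorem derivZ_comp_reflect {Y : ℝ × ℝ} (hG : DifferentiableAt ℝ G (-Y.1, Y.2)) :
    derivZ (fun q => G (-q.1, q.2)) Y = derivZ G (-Y.1, Y.2) := by
  have h : HasFDerivAt (fun q : ℝ × ℝ => G (-q.1, q.2))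
      ((fderiv ℝ G (-Y.1, Y.2)).comp
        ((-ContinuousLinearMap.fst ℝ ℝ ℝ).prod (ContinuousLinearMap.snd ℝ ℝ ℝ))) Y :=
    hG.hasFDerivAt.comp Y (hasFDerivAt_reflect Y)
  rw [derivZ_apply, h.fderiv, ContinuousLinearMap.comp_apply]
  simp only [ContinuousLinearMap.prod_apply, FunLike.coe_neg, Pi.neg_apply,
    ContinuousLinearMap.coe_fst', ContinuousLinearMap.coe_snd', neg_zero]
  rw [fderiv_apply_eq_derivR_derivZ]; ring

/-- The Fréchet derivative of a profile in terms of its two partials: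
`DG(Y) = ∂_R G(Y) · pr₁ + ∂_Z G(Y) · pr₂` (valid unconditionally). [folklore] -/
private theorem fderiv_eq_derivR_derivZ_clm (G : ℝ × ℝ → ℝ) (Y : ℝ × ℝ) :
    fderiv ℝ G Y = derivR G Y • ContinuousLinearMap.fst ℝ ℝ ℝ +
      derivZ G Y • ContinuousLinearMap.snd ℝ ℝ ℝ := by
  refine ContinuousLinearMap.ext fun v => ?_
  obtain ⟨a, b⟩ := v
  rw [fderiv_apply_eq_derivR_derivZ]
  simp [mul_comm]

/-- Operator-norm bound `‖DG(Y)‖ ≤ |∂_R G(Y)| + |∂_Z G(Y)|` (sup norm on `ℝ × ℝ`). [folklore] -/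
private theorem opNorm_fderiv_le (G : ℝ × ℝ → ℝ) (Y : ℝ × ℝ) :
    ‖fderiv ℝ G Y‖ ≤ |derivR G Y| + |derivZ G Y| := by
  refine ContinuousLinearMap.opNorm_le_bound _ (by positivity) fun v => ?_
  obtain ⟨a, b⟩ := v
  rw [fderiv_apply_eq_derivR_derivZ, Real.norm_eq_abs]
  have ha : |a| ≤ ‖((a, b) : ℝ × ℝ)‖ := norm_fst_le ((a, b) : ℝ × ℝ)
  have hb : |b| ≤ ‖((a, b) : ℝ × ℝ)‖ := norm_snd_le ((a, b) : ℝ × ℝ)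
  calc |a * derivR G Y + b * derivZ G Y| ≤ |a * derivR G Y| + |b * derivZ G Y| := abs_add_le _ _
    _ = |a| * |derivR G Y| + |b| * |derivZ G Y| := by rw [abs_mul, abs_mul]
    _ ≤ ‖((a, b) : ℝ × ℝ)‖ * |derivR G Y| + ‖((a, b) : ℝ × ℝ)‖ * |derivZ G Y| := by
        gcongr
    _ = (|derivR G Y| + |derivZ G Y|) * ‖((a, b) : ℝ × ℝ)‖ := by ring

/-- **Continuity extension to the wall.** A function continuous at a wall point `(0, Z)` and
constant on the open half-plane takes that constant value at the wall point. [folklore] -/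
private theorem eq_at_wall_of_eq_on_open {c : ℝ} {Z : ℝ} (hh : ContinuousAt h (0, Z))
    (hc : ∀ Y : ℝ × ℝ, Y.1 < 0 → h Y = c) : h (0, Z) = c := by
  -- approach the wall point along `r ↦ (r, Z)`, `r → 0⁻`
  have hcurve : Tendsto (fun r : ℝ => ((r, Z) : ℝ × ℝ)) (𝓝[<] 0) (𝓝 (0, Z)) := by
    have : Continuous fun r : ℝ => ((r, Z) : ℝ × ℝ) := continuous_id.prodMk continuous_const
    exact (this.tendsto' 0 (0, Z) rfl).mono_left nhdsWithin_le_nhds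
  have h1 : Tendsto (fun r : ℝ => h (r, Z)) (𝓝[<] 0) (𝓝 (h (0, Z))) := hh.tendsto.comp hcurve
  have h2 : Tendsto (fun r : ℝ => h (r, Z)) (𝓝[<] 0) (𝓝 c) := by
    refine tendsto_const_nhds.congr' ?_
    filter_upwards [self_mem_nhdsWithin] with r hr
    exact (hc (r, Z) hr).symm
  exact tendsto_nhds_unique h1 h2

/-- A `C¹` function on an open neighbourhood of the closed half-plane that vanishes on the closed
half-plane has vanishing partials there. [folklore] -/
private theorem derivR_derivZ_eq_zero_of_eq_zero (hO : IsOpen O) (hHO : {Y : ℝ × ℝ | Y.1 ≤ 0} ⊆ O)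
    (hG : ContDiffOn ℝ 1 G O) (h0 : ∀ Y : ℝ × ℝ, Y.1 ≤ 0 → G Y = 0) {Y : ℝ × ℝ} (hY : Y.1 ≤ 0) :
    derivR G Y = 0 ∧ derivZ G Y = 0 := by
  -- on the open half-plane `G` vanishes near every point
  have hopen : ∀ Y' : ℝ × ℝ, Y'.1 < 0 → derivR G Y' = 0 ∧ derivZ G Y' = 0 := by
    intro Y' hY'
    have hev : G =ᶠ[𝓝 Y'] fun _ => (0 : ℝ) := by
      have ho : IsOpen {q : ℝ × ℝ | q.1 < 0} := isOpen_lt continuous_fst continuous_const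
      filter_upwards [ho.mem_nhds hY'] with q hq
      exact h0 q hq.le
    rw [derivR_apply, derivZ_apply, hev.fderiv_eq]
    simp
  rcases hY.lt_or_eq with hlt | heq
  · exact hopen Y hlt
  · have hYO : Y ∈ O := hHO hY
    have hcR : ContinuousAt (derivR G) Y := (continuousOn_derivR_open hG hO).continuousAt (hO.mem_nhds hYO)
    have hcZ : ContinuousAt (derivZ G) Y := (continuousOn_derivZ_open hG hO).continuousAt (hO.mem_nhds hYO)
    have eY : Y = (0, Y.2) := by ext <;> simp [heq]
    rw [eY] at hcR hcZ ⊢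
    exact ⟨eq_at_wall_of_eq_on_open hcR fun Y' h => (hopen Y' h).1,
      eq_at_wall_of_eq_on_open hcZ fun Y' h => (hopen Y' h).2⟩

end HalfPlaneCalculus

/-! ### Engine B, step 1: `C¹` gluing across the wall -/

section Glue

variable {O₁ O₂ : Set (ℝ × ℝ)} {f₁ f₂ : ℝ × ℝ → ℝ}

/-- **`C¹` gluing across the wall.** Two `C¹` functions, one on an open neighbourhood of
`{R ≤ 0}`, the other on an open neighbourhood of `{R ≥ 0}`, that agree together with their two
partials on the wall `R = 0`, glue to a `C¹` function whose partials are the glued partials.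
[folklore] -/
private theorem glue_C1 (hO₁ : IsOpen O₁) (hO₂ : IsOpen O₂) (h₁ : {Y : ℝ × ℝ | Y.1 ≤ 0} ⊆ O₁)
    (h₂ : {Y : ℝ × ℝ | 0 ≤ Y.1} ⊆ O₂) (hf₁ : ContDiffOn ℝ 1 f₁ O₁) (hf₂ : ContDiffOn ℝ 1 f₂ O₂)
    (m0 : ∀ Z : ℝ, f₁ (0, Z) = f₂ (0, Z)) (mR : ∀ Z : ℝ, derivR f₁ (0, Z) = derivR f₂ (0, Z))
    (mZ : ∀ Z : ℝ, derivZ f₁ (0, Z) = derivZ f₂ (0, Z)) :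
    ContDiff ℝ 1 (fun Y : ℝ × ℝ => if Y.1 ≤ 0 then f₁ Y else f₂ Y) ∧
    (∀ Y : ℝ × ℝ, derivR (fun Y : ℝ × ℝ => if Y.1 ≤ 0 then f₁ Y else f₂ Y) Y =
      if Y.1 ≤ 0 then derivR f₁ Y else derivR f₂ Y) ∧
    (∀ Y : ℝ × ℝ, derivZ (fun Y : ℝ × ℝ => if Y.1 ≤ 0 then f₁ Y else f₂ Y) Y =
      if Y.1 ≤ 0 then derivZ f₁ Y else derivZ f₂ Y) := by
  set g : ℝ × ℝ → ℝ := fun Y => if Y.1 ≤ 0 then f₁ Y else f₂ Y with hgdef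
  set L : ℝ × ℝ → (ℝ × ℝ →L[ℝ] ℝ) := fun Y => if Y.1 ≤ 0 then fderiv ℝ f₁ Y else fderiv ℝ f₂ Y
    with hLdef
  have hlt_open : IsOpen {q : ℝ × ℝ | q.1 < 0} := isOpen_lt continuous_fst continuous_const
  have hgt_open : IsOpen {q : ℝ × ℝ | 0 < q.1} := isOpen_lt continuous_const continuous_fst
  -- the derivatives of the two pieces agree on the wall
  have hLwall : ∀ Y : ℝ × ℝ, Y.1 = 0 → fderiv ℝ f₁ Y = fderiv ℝ f₂ Y := by
    intro Y hY
    have eY : Y = (0, Y.2) := by ext <;> simp [hY]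
    rw [fderiv_eq_derivR_derivZ_clm f₁, fderiv_eq_derivR_derivZ_clm f₂, eY, mR, mZ]
  -- `g` has derivative `L` everywhere
  have hderiv : ∀ Y, HasFDerivAt g (L Y) Y := by
    intro Y
    rcases lt_trichotomy Y.1 0 with hlt | heq | hgt
    · have hev : g =ᶠ[𝓝 Y] f₁ := by
        filter_upwards [hlt_open.mem_nhds hlt] with q hq
        simp [hgdef, hq.le]
      have hd : HasFDerivAt f₁ (fderiv ℝ f₁ Y) Y :=
        (differentiableAt_of_contDiffOn_open hf₁ hO₁ one_ne_zero (h₁ hlt.le)).hasFDerivAt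
      have : L Y = fderiv ℝ f₁ Y := by simp [hLdef, hlt.le]
      rw [this]
      exact hd.congr_of_eventuallyEq hev
    · have hd₁ : HasFDerivAt f₁ (fderiv ℝ f₁ Y) Y :=
        (differentiableAt_of_contDiffOn_open hf₁ hO₁ one_ne_zero (h₁ heq.le)).hasFDerivAt
      have hd₂ : HasFDerivAt f₂ (fderiv ℝ f₁ Y) Y := by
        rw [hLwall Y heq]
        exact (differentiableAt_of_contDiffOn_open hf₂ hO₂ one_ne_zero (h₂ heq.ge)).hasFDerivAt
      have hLY : L Y = fderiv ℝ f₁ Y := by simp [hLdef, heq.le]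
      rw [hLY]
      have eY : Y = (0, Y.2) := by ext <;> simp [heq]
      refine hasFDerivAt_of_either hd₁ hd₂ (by simp [hgdef, heq.le]) ?_ fun y => ?_
      · simp only [hgdef, heq.le, if_true]
        rw [eY]; exact m0 Y.2
      · by_cases hy : y.1 ≤ 0
        · left; simp [hgdef, hy]
        · right; simp [hgdef, hy]
    · have hev : g =ᶠ[𝓝 Y] f₂ := by
        filter_upwards [hgt_open.mem_nhds hgt] with q hq
        simp [hgdef, not_le.2 hq]
      have hd : HasFDerivAt f₂ (fderiv ℝ f₂ Y) Y :=
        (differentiableAt_of_contDiffOn_open hf₂ hO₂ one_ne_zero (h₂ hgt.le)).hasFDerivAt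
      have : L Y = fderiv ℝ f₂ Y := by simp [hLdef, not_le.2 hgt]
      rw [this]
      exact hd.congr_of_eventuallyEq hev
  -- `L` is continuous
  have hc₁ : ContinuousOn (fderiv ℝ f₁) O₁ := hf₁.continuousOn_fderiv_of_isOpen hO₁ le_rfl
  have hc₂ : ContinuousOn (fderiv ℝ f₂) O₂ := hf₂.continuousOn_fderiv_of_isOpen hO₂ le_rfl
  have hLcont : Continuous L := by
    rw [continuous_iff_continuousAt]
    intro Y
    rcases lt_trichotomy Y.1 0 with hlt | heq | hgt
    · have hev : L =ᶠ[𝓝 Y] fderiv ℝ f₁ := by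
        filter_upwards [hlt_open.mem_nhds hlt] with q hq
        simp [hLdef, hq.le]
      exact (continuousAt_congr hev).2 (hc₁.continuousAt (hO₁.mem_nhds (h₁ hlt.le)))
    · refine continuousAt_of_either (hc₁.continuousAt (hO₁.mem_nhds (h₁ heq.le)))
        (hc₂.continuousAt (hO₂.mem_nhds (h₂ heq.ge))) (by simp [hLdef, heq.le]) ?_ fun y => ?_
      · simp only [hLdef, heq.le, if_true]; exact hLwall Y heq
      · by_cases hy : y.1 ≤ 0
        · left; simp [hLdef, hy]
        · right; simp [hLdef, hy]
    · have hev : L =ᶠ[𝓝 Y] fderiv ℝ f₂ := by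
        filter_upwards [hgt_open.mem_nhds hgt] with q hq
        simp [hLdef, not_le.2 hq]
      exact (continuousAt_congr hev).2 (hc₂.continuousAt (hO₂.mem_nhds (h₂ hgt.le)))
  have hC1 : ContDiff ℝ 1 g := by
    rw [show (1 : WithTop ℕ∞) = ((0 : ℕ) : WithTop ℕ∞) + 1 by norm_num]
    exact contDiff_succ_iff_hasFDerivAt.2 ⟨L, contDiff_zero.2 hLcont, hderiv⟩
  have hfd : ∀ Y, fderiv ℝ g Y = L Y := fun Y => (hderiv Y).fderiv
  refine ⟨hC1, fun Y => ?_, fun Y => ?_⟩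
  · rw [derivR_apply, hfd Y]
    by_cases hY : Y.1 ≤ 0
    · simp [hLdef, hY, derivR_apply]
    · simp [hLdef, hY, derivR_apply]
  · rw [derivZ_apply, hfd Y]
    by_cases hY : Y.1 ≤ 0
    · simp [hLdef, hY, derivZ_apply]
    · simp [hLdef, hY, derivZ_apply]

end Glue

/-! ### Engine B, step 2: the odd reflection of a function harmonic up to the wall is `C²`
and harmonic on the plane -/

section Reflection

variable {O : Set (ℝ × ℝ)} {Φ : ℝ × ℝ → ℝ}

/-- `∂_R`, `∂_Z` only depend on the germ. [folklore] -/
private theorem derivR_congr_nhds {f g : ℝ × ℝ → ℝ} {Y : ℝ × ℝ} (h : f =ᶠ[𝓝 Y] g) :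
    derivR f Y = derivR g Y := by
  rw [derivR_apply, h.fderiv_eq, derivR_apply]

/-- `∂_R`, `∂_Z` only depend on the germ. [folklore] -/
private theorem derivZ_congr_nhds {f g : ℝ × ℝ → ℝ} {Y : ℝ × ℝ} (h : f =ᶠ[𝓝 Y] g) :
    derivZ f Y = derivZ g Y := by
  rw [derivZ_apply, h.fderiv_eq, derivZ_apply]

/-- A function vanishing along the wall has vanishing tangential derivative there. [folklore] -/
private theorem derivZ_wall_eq_zero (hO : IsOpen O) (hHO : {Y : ℝ × ℝ | Y.1 ≤ 0} ⊆ O)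
    {G : ℝ × ℝ → ℝ} {n : WithTop ℕ∞} (hG : ContDiffOn ℝ n G O) (hn : n ≠ 0)
    (h0 : ∀ Z : ℝ, G (0, Z) = 0) (Z : ℝ) : derivZ G (0, Z) = 0 := by
  have hd : DifferentiableAt ℝ G (0, Z) :=
    differentiableAt_of_contDiffOn_open hG hO hn (hHO (show ((0 : ℝ), Z).1 ≤ 0 from le_rfl))
  have h := hasDerivAt_sliceZ_pt hd
  simp only at h
  have hzero : (fun z : ℝ => G (0, z)) = fun _ => 0 := funext h0
  rw [hzero] at h
  have := h.deriv
  rw [deriv_const] at this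
  exact this.symm

/-- **Odd reflection across the wall.** Let `Φ` be `C²` on an open neighbourhood of the closed
half-plane `{R ≤ 0}`, vanish on the wall `R = 0`, and satisfy `ΔΦ = 0` on the closed half-plane.
Then its odd reflection `Φ̃(R, Z) = Φ(R, Z)` (`R ≤ 0`), `= −Φ(−R, Z)` (`R > 0`) is `C²` on the
plane with `ΔΦ̃ = 0` (Schwarz reflection for harmonic functions, in the `C²`-up-to-the-boundary
case where it is elementary). [folklore] -/
private theorem oddReflection_C2_harmonic (hO : IsOpen O) (hHO : {Y : ℝ × ℝ | Y.1 ≤ 0} ⊆ O)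
    (hΦ : ContDiffOn ℝ 2 Φ O) (h0 : ∀ Z : ℝ, Φ (0, Z) = 0)
    (hΔ : ∀ Y : ℝ × ℝ, Y.1 ≤ 0 → derivR (derivR Φ) Y + derivZ (derivZ Φ) Y = 0) :
    ContDiff ℝ 2 (fun Y : ℝ × ℝ => if Y.1 ≤ 0 then Φ Y else -Φ (-Y.1, Y.2)) ∧
    ∀ Y : ℝ × ℝ,
      derivR (derivR (fun Y : ℝ × ℝ => if Y.1 ≤ 0 then Φ Y else -Φ (-Y.1, Y.2))) Y +
      derivZ (derivZ (fun Y : ℝ × ℝ => if Y.1 ≤ 0 then Φ Y else -Φ (-Y.1, Y.2))) Y = 0 := by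
  -- the reflected domain and the reflected piece
  set O₂ : Set (ℝ × ℝ) := (fun q : ℝ × ℝ => ((-q.1, q.2) : ℝ × ℝ)) ⁻¹' O with hO₂def
  have hO₂ : IsOpen O₂ := hO.preimage contDiff_reflect.continuous
  have h₂ : {Y : ℝ × ℝ | 0 ≤ Y.1} ⊆ O₂ := fun Y hY => hHO (by simpa using hY)
  set f₂ : ℝ × ℝ → ℝ := fun Y => -Φ (-Y.1, Y.2) with hf₂def
  have hf₂ : ContDiffOn ℝ 2 f₂ O₂ :=
    (hΦ.comp ((contDiff_reflect.of_le (WithTop.coe_le_coe.2 le_top)).contDiffOn)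
      (mapsTo_preimage _ _)).neg
  have hΦ1 : ContDiffOn ℝ 1 Φ O := hΦ.of_le one_le_two
  have hf₂1 : ContDiffOn ℝ 1 f₂ O₂ := hf₂.of_le one_le_two
  -- differentiability facts
  have dΦ : ∀ Y ∈ O, DifferentiableAt ℝ Φ Y := fun Y hY =>
    differentiableAt_of_contDiffOn_open hΦ hO two_ne_zero hY
  have dΦR : ∀ Y ∈ O, DifferentiableAt ℝ (derivR Φ) Y := fun Y hY =>
    differentiableAt_of_contDiffOn_open (contDiffOn_derivR_open hΦ hO) hO one_ne_zero hY
  have dΦZ : ∀ Y ∈ O, DifferentiableAt ℝ (derivZ Φ) Y := fun Y hY =>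
    differentiableAt_of_contDiffOn_open (contDiffOn_derivZ_open hΦ hO) hO one_ne_zero hY
  have memO₂ : ∀ {Y : ℝ × ℝ}, Y ∈ O₂ → ((-Y.1, Y.2) : ℝ × ℝ) ∈ O := fun hY => hY
  -- first partials of the reflected piece
  have dR₂ : ∀ Y ∈ O₂, derivR f₂ Y = derivR Φ (-Y.1, Y.2) := by
    intro Y hY
    rw [hf₂def, derivR_fun_neg, derivR_comp_reflect (dΦ _ (memO₂ hY))]; ring
  have dZ₂ : ∀ Y ∈ O₂, derivZ f₂ Y = -derivZ Φ (-Y.1, Y.2) := by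
    intro Y hY
    rw [hf₂def, derivZ_fun_neg, derivZ_comp_reflect (dΦ _ (memO₂ hY))]
  -- second partials of the reflected piece
  have evR₂ : ∀ Y ∈ O₂, derivR f₂ =ᶠ[𝓝 Y] fun q => derivR Φ (-q.1, q.2) := by
    intro Y hY
    filter_upwards [hO₂.mem_nhds hY] with q hq
    exact dR₂ q hq
  have evZ₂ : ∀ Y ∈ O₂, derivZ f₂ =ᶠ[𝓝 Y] fun q => -derivZ Φ (-q.1, q.2) := by
    intro Y hY
    filter_upwards [hO₂.mem_nhds hY] with q hq
    exact dZ₂ q hq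
  have dRR₂ : ∀ Y ∈ O₂, derivR (derivR f₂) Y = -derivR (derivR Φ) (-Y.1, Y.2) := by
    intro Y hY
    rw [derivR_congr_nhds (evR₂ Y hY), derivR_comp_reflect (dΦR _ (memO₂ hY))]
  have dZR₂ : ∀ Y ∈ O₂, derivZ (derivR f₂) Y = derivZ (derivR Φ) (-Y.1, Y.2) := by
    intro Y hY
    rw [derivZ_congr_nhds (evR₂ Y hY), derivZ_comp_reflect (dΦR _ (memO₂ hY))]
  have dRZ₂ : ∀ Y ∈ O₂, derivR (derivZ f₂) Y = derivR (derivZ Φ) (-Y.1, Y.2) := by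
    intro Y hY
    rw [derivR_congr_nhds (evZ₂ Y hY), derivR_fun_neg, derivR_comp_reflect (dΦZ _ (memO₂ hY))]
    ring
  have dZZ₂ : ∀ Y ∈ O₂, derivZ (derivZ f₂) Y = -derivZ (derivZ Φ) (-Y.1, Y.2) := by
    intro Y hY
    rw [derivZ_congr_nhds (evZ₂ Y hY), derivZ_fun_neg, derivZ_comp_reflect (dΦZ _ (memO₂ hY))]
  -- wall facts
  have wallO : ∀ Z : ℝ, ((0 : ℝ), Z) ∈ O := fun Z => hHO (show ((0 : ℝ), Z).1 ≤ 0 from le_rfl)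
  have wallO₂ : ∀ Z : ℝ, ((0 : ℝ), Z) ∈ O₂ := fun Z => h₂ (show (0 : ℝ) ≤ ((0 : ℝ), Z).1 from le_rfl)
  have w1 : ∀ Z : ℝ, derivZ Φ (0, Z) = 0 := derivZ_wall_eq_zero hO hHO hΦ two_ne_zero h0
  have w2 : ∀ Z : ℝ, derivZ (derivZ Φ) (0, Z) = 0 :=
    derivZ_wall_eq_zero hO hHO (contDiffOn_derivZ_open hΦ hO) one_ne_zero w1
  have w3 : ∀ Z : ℝ, derivR (derivR Φ) (0, Z) = 0 := fun Z => by
    have := hΔ (0, Z) le_rfl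
    rw [w2 Z, add_zero] at this
    exact this
  -- three gluings
  obtain ⟨gC1, gR, gZ⟩ := glue_C1 hO hO₂ hHO h₂ hΦ1 hf₂1
    (fun Z => by simp [hf₂def, h0 Z])
    (fun Z => by rw [dR₂ _ (wallO₂ Z)]; simp)
    (fun Z => by rw [dZ₂ _ (wallO₂ Z)]; simp [w1 Z])
  obtain ⟨rC1, rR, rZ⟩ := glue_C1 hO hO₂ hHO h₂ (contDiffOn_derivR_open hΦ hO)
    (contDiffOn_derivR_open hf₂ hO₂)
    (fun Z => by rw [dR₂ _ (wallO₂ Z)]; simp)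
    (fun Z => by rw [dRR₂ _ (wallO₂ Z)]; simp [w3 Z])
    (fun Z => by rw [dZR₂ _ (wallO₂ Z)]; simp)
  obtain ⟨zC1, zR, zZ⟩ := glue_C1 hO hO₂ hHO h₂ (contDiffOn_derivZ_open hΦ hO)
    (contDiffOn_derivZ_open hf₂ hO₂)
    (fun Z => by rw [dZ₂ _ (wallO₂ Z)]; simp [w1 Z])
    (fun Z => by rw [dRZ₂ _ (wallO₂ Z)]; simp)
    (fun Z => by rw [dZZ₂ _ (wallO₂ Z)]; simp [w2 Z])
  set g : ℝ × ℝ → ℝ := fun Y => if Y.1 ≤ 0 then Φ Y else f₂ Y with hgdef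
  -- the partials of `g` ARE the glued partials
  have eR : derivR g = fun Y : ℝ × ℝ => if Y.1 ≤ 0 then derivR Φ Y else derivR f₂ Y := funext gR
  have eZ : derivZ g = fun Y : ℝ × ℝ => if Y.1 ≤ 0 then derivZ Φ Y else derivZ f₂ Y := funext gZ
  have hfd : fderiv ℝ g = fun Y => derivR g Y • ContinuousLinearMap.fst ℝ ℝ ℝ +
      derivZ g Y • ContinuousLinearMap.snd ℝ ℝ ℝ := funext fun Y => fderiv_eq_derivR_derivZ_clm g Y
  have hfdC1 : ContDiff ℝ 1 (fderiv ℝ g) := by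
    rw [hfd, eR, eZ]
    exact (rC1.smul contDiff_const).add (zC1.smul contDiff_const)
  have hC2 : ContDiff ℝ 2 g := by
    rw [show (2 : WithTop ℕ∞) = ((1 : ℕ) : WithTop ℕ∞) + 1 by norm_num]
    refine contDiff_succ_iff_hasFDerivAt.2 ⟨fderiv ℝ g, ?_, fun Y => ?_⟩
    · exact_mod_cast hfdC1
    · exact ((gC1.differentiable one_ne_zero) Y).hasFDerivAt
  refine ⟨hC2, fun Y => ?_⟩
  rw [eR, eZ, rR, zZ]
  by_cases hY : Y.1 ≤ 0
  · simp only [hY, if_true]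
    exact hΔ Y hY
  · simp only [hY, if_false]
    have hY' : Y ∈ O₂ := h₂ (le_of_lt (not_le.1 hY))
    rw [dRR₂ Y hY', dZZ₂ Y hY']
    have := hΔ (-Y.1, Y.2) (by simp only; linarith [not_le.1 hY])
    linear_combination -this

end Reflection

/-! ### Engine B, step 3: transfer to Mathlib's harmonic functions on `ℂ` -/

section Transfer

/-- A `C²` function `g` on `ℝ × ℝ` with `∂_R∂_R g + ∂_Z∂_Z g = 0` everywhere defines a harmonic
function `z ↦ g (Re z, Im z)` on `ℂ` in Mathlib's sense. [folklore] -/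
private theorem harmonicOnNhd_of_laplace {g : ℝ × ℝ → ℝ} (hg : ContDiff ℝ 2 g)
    (hΔ : ∀ Y : ℝ × ℝ, derivR (derivR g) Y + derivZ (derivZ g) Y = 0) :
    InnerProductSpace.HarmonicOnNhd (fun z : ℂ => g (z.re, z.im)) univ := by
  set e : ℂ →L[ℝ] ℝ × ℝ := (Complex.equivRealProdCLM : ℂ ≃L[ℝ] ℝ × ℝ).toContinuousLinearMap
    with hedef
  have he : ∀ z : ℂ, e z = (z.re, z.im) := fun z => rfl
  have hfun : (fun z : ℂ => g (z.re, z.im)) = g ∘ e := by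
    funext z; simp [he]
  intro z _
  refine ⟨?_, ?_⟩
  · rw [hfun]
    exact (hg.comp e.contDiff).contDiffAt
  · rw [hfun, InnerProductSpace.laplacian_eq_iteratedFDeriv_complexPlane]
    refine Filter.Eventually.of_forall fun w => ?_
    have hcomp := ContinuousLinearMap.iteratedFDeriv_comp_right e hg w (i := 2) le_rfl
    simp only [Pi.zero_apply]
    rw [hcomp]
    simp only [ContinuousMultilinearMap.compContinuousLinearMap_apply]
    have h1 : (fun i : Fin 2 => e (![(1 : ℂ), 1] i)) = ![((1 : ℝ), (0 : ℝ)), ((1 : ℝ), (0 : ℝ))] := by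
      funext i
      fin_cases i <;> simp [he]
    have h2 : (fun i : Fin 2 => e (![Complex.I, Complex.I] i)) =
        ![((0 : ℝ), (1 : ℝ)), ((0 : ℝ), (1 : ℝ))] := by
      funext i
      fin_cases i <;> simp [he]
    rw [h1, h2, iteratedFDeriv_two_apply, iteratedFDeriv_two_apply]
    simp only [Matrix.cons_val_zero, Matrix.cons_val_one]
    rw [← Calculus.fderiv_fderiv_apply_const hg, ← Calculus.fderiv_fderiv_apply_const hg]
    have := hΔ (e w)
    rw [derivR_apply, derivZ_apply] at this
    have eR : (fun y => fderiv ℝ g y ((1 : ℝ), (0 : ℝ))) = derivR g := funext fun y => (derivR_apply g y).symm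
    have eZ : (fun y => fderiv ℝ g y ((0 : ℝ), (1 : ℝ))) = derivZ g := funext fun y => (derivZ_apply g y).symm
    rw [eR, eZ]
    exact this

end Transfer

/-! ### Engine B: a stream profile with constant Laplacian, wall condition and sub-linear
gradient is affine in `R` (Chae–Tsai's harmonic step, with the printed gap closed) -/

section Stream

variable {O : Set (ℝ × ℝ)}

/-- Explicit partials of the quadratic comparison polynomial
`e(R, Z) = A·R·Z + B·R + β + (κ/2)·R²`. [folklore] -/
private theorem derivs_explicit (A B β κ : ℝ) (Y : ℝ × ℝ) :
    derivR (fun q : ℝ × ℝ => A * q.1 * q.2 + B * q.1 + β + κ / 2 * q.1 ^ 2) Y =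
        A * Y.2 + B + κ * Y.1 ∧
    derivZ (fun q : ℝ × ℝ => A * q.1 * q.2 + B * q.1 + β + κ / 2 * q.1 ^ 2) Y = A * Y.1 ∧
    derivR (derivR (fun q : ℝ × ℝ => A * q.1 * q.2 + B * q.1 + β + κ / 2 * q.1 ^ 2)) Y = κ ∧
    derivZ (derivZ (fun q : ℝ × ℝ => A * q.1 * q.2 + B * q.1 + β + κ / 2 * q.1 ^ 2)) Y = 0 := by
  set e : ℝ × ℝ → ℝ := fun q => A * q.1 * q.2 + B * q.1 + β + κ / 2 * q.1 ^ 2 with hedef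
  have he : ContDiff ℝ ∞ e := by
    rw [hedef]; fun_prop
  have hR : ∀ q : ℝ × ℝ, derivR e q = A * q.2 + B + κ * q.1 := by
    intro q
    obtain ⟨r, z⟩ := q
    rw [derivR_slice he]
    have h : HasDerivAt (fun s : ℝ => A * s * z + B * s + β + κ / 2 * s ^ 2)
        (A * 1 * z + B * 1 + κ / 2 * ((2 : ℕ) * r ^ (2 - 1))) r := by
      have hid := hasDerivAt_id' r
      exact ((((hid.const_mul A).mul_const z).add (hid.const_mul B)).add_const β).add
        ((hasDerivAt_pow 2 r).const_mul (κ / 2))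
    simp only [hedef]
    rw [h.deriv]; norm_num; ring
  have hZ : ∀ q : ℝ × ℝ, derivZ e q = A * q.1 := by
    intro q
    obtain ⟨r, z⟩ := q
    rw [derivZ_slice he]
    have h : HasDerivAt (fun s : ℝ => A * r * s + (B * r + β + κ / 2 * r ^ 2)) (A * r * 1) z := by
      have hid := hasDerivAt_id' z
      exact (hid.const_mul (A * r)).add_const (B * r + β + κ / 2 * r ^ 2)
    simp only [hedef]
    rw [show (fun s : ℝ => A * (r, s).1 * (r, s).2 + B * (r, s).1 + β + κ / 2 * (r, s).1 ^ 2) =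
      fun s => A * r * s + (B * r + β + κ / 2 * r ^ 2) from funext fun s => by simp only; ring]
    rw [h.deriv]; ring
  refine ⟨hR Y, hZ Y, ?_, ?_⟩
  · rw [show derivR e = fun q : ℝ × ℝ => A * q.2 + B + κ * q.1 from funext hR]
    obtain ⟨r, z⟩ := Y
    rw [derivR_slice (by fun_prop)]
    have h : HasDerivAt (fun s : ℝ => A * z + B + κ * s) (κ * 1) r :=
      ((hasDerivAt_id' r).const_mul κ).const_add (A * z + B)
    simp only
    rw [h.deriv]; ring
  · rw [show derivZ e = fun q : ℝ × ℝ => A * q.1 from funext hZ]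
    obtain ⟨r, z⟩ := Y
    rw [derivZ_slice (by fun_prop)]
    simp

/-- **Engine B (Chae–Tsai's harmonic step, gap closed).** Let `Ψ` be `C²` on an open
neighbourhood of the closed half-plane `𝒟̄ = {R ≤ 0}` with the wall condition `∂_ZΨ(0, Z) = 0`,
constant Laplacian `ΔΨ = κ` on the open half-plane, and sub-linear gradient
`|∇Ψ(Y)| = o(|Y|)` on `𝒟̄`. Then `κ = 0` and `Ψ = aR + b` on `𝒟̄`. (Print: "`Ψ₀` and `∇Ψ₀` are
harmonic. By the boundary conditions […] we get `∂_ZΨ₀ = 0`. Thus `Ψ₀ = Ψ₀(R)` […] `Ψ₀ = aR + b`";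
here via odd reflection across the wall and Liouville for harmonic functions of quadratic growth.
The vanishing of `κ` is what closes print's "`a = 0`" one order later.)
[cite: ChaeTsai2015, §3, proof of Thm. 2 (arXiv p. 5), the `Ψ₀`/`Ψ_k` step] -/
theorem stream_affine_of_wall_of_sublinearGradient (hO : IsOpen O)
    (hHO : {Y : ℝ × ℝ | Y.1 ≤ 0} ⊆ O) {Ψ : ℝ × ℝ → ℝ} {κ : ℝ} (hΨ : ContDiffOn ℝ 2 Ψ O)
    (hwall : ∀ Z : ℝ, derivZ Ψ (0, Z) = 0)
    (hpoisson : ∀ Y : ℝ × ℝ, Y.1 < 0 → derivR (derivR Ψ) Y + derivZ (derivZ Ψ) Y = κ)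
    (hgrad : ∀ ε : ℝ, 0 < ε → ∃ M : ℝ, ∀ Y : ℝ × ℝ, Y.1 ≤ 0 → M ≤ ‖Y‖ →
      |derivR Ψ Y| + |derivZ Ψ Y| ≤ ε * ‖Y‖) :
    κ = 0 ∧ ∃ a b : ℝ, ∀ Y : ℝ × ℝ, Y.1 ≤ 0 →
      Ψ Y = a * Y.1 + b ∧ derivR Ψ Y = a ∧ derivZ Ψ Y = 0 := by
  have wallO : ∀ Z : ℝ, ((0 : ℝ), Z) ∈ O := fun Z => hHO (show ((0 : ℝ), Z).1 ≤ 0 from le_rfl)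
  have dΨ : ∀ Y ∈ O, DifferentiableAt ℝ Ψ Y := fun Y hY =>
    differentiableAt_of_contDiffOn_open hΨ hO two_ne_zero hY
  have hΨR1 : ContDiffOn ℝ 1 (derivR Ψ) O := contDiffOn_derivR_open hΨ hO
  have hΨZ1 : ContDiffOn ℝ 1 (derivZ Ψ) O := contDiffOn_derivZ_open hΨ hO
  have dΨR : ∀ Y ∈ O, DifferentiableAt ℝ (derivR Ψ) Y := fun Y hY =>
    differentiableAt_of_contDiffOn_open hΨR1 hO one_ne_zero hY
  have dΨZ : ∀ Y ∈ O, DifferentiableAt ℝ (derivZ Ψ) Y := fun Y hY =>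
    differentiableAt_of_contDiffOn_open hΨZ1 hO one_ne_zero hY
  -- S1: `Ψ` is constant `β` along the wall
  set β : ℝ := Ψ (0, 0) with hβdef
  have hβ : ∀ Z : ℝ, Ψ (0, Z) = β := by
    have hd : ∀ z : ℝ, HasDerivAt (fun z : ℝ => Ψ (0, z)) (derivZ Ψ (0, z)) z := fun z => by
      have := hasDerivAt_sliceZ_pt (dΨ _ (wallO z)); simpa using this
    have hdiff : Differentiable ℝ fun z : ℝ => Ψ (0, z) := fun z => (hd z).differentiableAt
    have hzero : ∀ z : ℝ, deriv (fun z : ℝ => Ψ (0, z)) z = 0 := fun z => by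
      rw [(hd z).deriv, hwall z]
    intro Z
    exact is_const_of_deriv_eq_zero hdiff hzero Z 0
  -- S2/S3: subtract the comparison polynomial; `Φ` vanishes on the wall and is harmonic
  set Φ : ℝ × ℝ → ℝ := fun Y => Ψ Y + ((0 : ℝ) * Y.1 * Y.2 + 0 * Y.1 + (-β) + (-κ) / 2 * Y.1 ^ 2)
    with hΦdef
  have hp : ContDiff ℝ ∞ fun Y : ℝ × ℝ =>
      (0 : ℝ) * Y.1 * Y.2 + 0 * Y.1 + (-β) + (-κ) / 2 * Y.1 ^ 2 := by fun_prop
  have hp2 : ContDiff ℝ 2 fun Y : ℝ × ℝ =>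
      (0 : ℝ) * Y.1 * Y.2 + 0 * Y.1 + (-β) + (-κ) / 2 * Y.1 ^ 2 := hp.of_le (WithTop.coe_le_coe.2 le_top)
  have hΦ : ContDiffOn ℝ 2 Φ O := hΨ.add hp2.contDiffOn
  have hΦ0 : ∀ Z : ℝ, Φ (0, Z) = 0 := fun Z => by simp [hΦdef, hβ Z]
  have dp := fun Y : ℝ × ℝ => derivs_explicit 0 0 (-β) (-κ) Y
  have hΦR : ∀ Y ∈ O, derivR Φ Y = derivR Ψ Y - κ * Y.1 := by
    intro Y hY
    rw [hΦdef, derivR_add_pt (dΨ Y hY) ((hp.differentiable (by simp)) Y), (dp Y).1]; ring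
  have hΦZ : ∀ Y ∈ O, derivZ Φ Y = derivZ Ψ Y := by
    intro Y hY
    rw [hΦdef, derivZ_add_pt (dΨ Y hY) ((hp.differentiable (by simp)) Y), (dp Y).2.1]; ring
  have hpR : ContDiff ℝ ∞ (derivR fun Y : ℝ × ℝ =>
      (0 : ℝ) * Y.1 * Y.2 + 0 * Y.1 + (-β) + (-κ) / 2 * Y.1 ^ 2) := contDiff_derivR hp
  have hpZ : ContDiff ℝ ∞ (derivZ fun Y : ℝ × ℝ =>
      (0 : ℝ) * Y.1 * Y.2 + 0 * Y.1 + (-β) + (-κ) / 2 * Y.1 ^ 2) := contDiff_derivZ hp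
  have hΦRR : ∀ Y ∈ O, derivR (derivR Φ) Y = derivR (derivR Ψ) Y - κ := by
    intro Y hY
    have hev : derivR Φ =ᶠ[𝓝 Y] fun q => derivR Ψ q + derivR (fun Y : ℝ × ℝ =>
        (0 : ℝ) * Y.1 * Y.2 + 0 * Y.1 + (-β) + (-κ) / 2 * Y.1 ^ 2) q := by
      filter_upwards [hO.mem_nhds hY] with q hq
      rw [hΦdef, derivR_add_pt (dΨ q hq) ((hp.differentiable (by simp)) q)]
    rw [derivR_congr_nhds hev, derivR_add_pt (dΨR Y hY) ((hpR.differentiable (by simp)) Y),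
      (dp Y).2.2.1]; ring
  have hΦZZ : ∀ Y ∈ O, derivZ (derivZ Φ) Y = derivZ (derivZ Ψ) Y := by
    intro Y hY
    have hev : derivZ Φ =ᶠ[𝓝 Y] fun q => derivZ Ψ q + derivZ (fun Y : ℝ × ℝ =>
        (0 : ℝ) * Y.1 * Y.2 + 0 * Y.1 + (-β) + (-κ) / 2 * Y.1 ^ 2) q := by
      filter_upwards [hO.mem_nhds hY] with q hq
      rw [hΦdef, derivZ_add_pt (dΨ q hq) ((hp.differentiable (by simp)) q)]
    rw [derivZ_congr_nhds hev, derivZ_add_pt (dΨZ Y hY) ((hpZ.differentiable (by simp)) Y),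
      (dp Y).2.2.2]; ring
  have hΔopen : ∀ Y : ℝ × ℝ, Y.1 < 0 → derivR (derivR Φ) Y + derivZ (derivZ Φ) Y = 0 := by
    intro Y hY
    rw [hΦRR Y (hHO hY.le), hΦZZ Y (hHO hY.le)]
    linear_combination hpoisson Y hY
  -- extend `ΔΦ = 0` to the wall by continuity of the second partials
  have hΦR1 : ContDiffOn ℝ 1 (derivR Φ) O := contDiffOn_derivR_open hΦ hO
  have hΦZ1 : ContDiffOn ℝ 1 (derivZ Φ) O := contDiffOn_derivZ_open hΦ hO
  have hΔ : ∀ Y : ℝ × ℝ, Y.1 ≤ 0 → derivR (derivR Φ) Y + derivZ (derivZ Φ) Y = 0 := by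
    intro Y hY
    rcases hY.lt_or_eq with hlt | heq
    · exact hΔopen Y hlt
    · have eY : Y = (0, Y.2) := by ext <;> simp [heq]
      have hc : ContinuousAt (fun q => derivR (derivR Φ) q + derivZ (derivZ Φ) q) (0, Y.2) :=
        ((continuousOn_derivR_open hΦR1 hO).continuousAt (hO.mem_nhds (wallO _))).add
          ((continuousOn_derivZ_open hΦZ1 hO).continuousAt (hO.mem_nhds (wallO _)))
      rw [eY]
      exact eq_at_wall_of_eq_on_open hc hΔopen
  -- S4: quadratic growth of `Φ` on the closed half-plane
  obtain ⟨M₁, hM₁⟩ := hgrad 1 one_pos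
  obtain ⟨C₀, hC₀nn, hC₀⟩ : ∃ C₀ : ℝ, 0 ≤ C₀ ∧ ∀ Y : ℝ × ℝ, Y.1 ≤ 0 → ‖Y‖ ≤ max M₁ 0 →
      |derivR Ψ Y| + |derivZ Ψ Y| ≤ C₀ := by
    have hK : IsCompact ({Y : ℝ × ℝ | Y.1 ≤ 0} ∩ Metric.closedBall (0 : ℝ × ℝ) (max M₁ 0)) :=
      (isCompact_closedBall _ _).inter_left (isClosed_le continuous_fst continuous_const)
    have hcont : ContinuousOn (fun Y => |derivR Ψ Y| + |derivZ Ψ Y|)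
        ({Y : ℝ × ℝ | Y.1 ≤ 0} ∩ Metric.closedBall (0 : ℝ × ℝ) (max M₁ 0)) :=
      (((continuousOn_derivR_open (hΨ.of_le one_le_two) hO).abs).add
        ((continuousOn_derivZ_open (hΨ.of_le one_le_two) hO).abs)).mono
        fun Y hY => hHO hY.1
    obtain ⟨C₀, hC₀⟩ := hK.exists_bound_of_continuousOn hcont
    refine ⟨max C₀ 0, le_max_right _ _, fun Y hY1 hY2 => ?_⟩
    have := hC₀ Y ⟨hY1, mem_closedBall_zero_iff.2 hY2⟩
    rw [Real.norm_eq_abs, abs_of_nonneg (by positivity)] at this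
    exact this.trans (le_max_left _ _)
  have hgradall : ∀ Y : ℝ × ℝ, Y.1 ≤ 0 → |derivR Ψ Y| + |derivZ Ψ Y| ≤ C₀ + ‖Y‖ := by
    intro Y hY
    by_cases h : ‖Y‖ ≤ max M₁ 0
    · exact (hC₀ Y hY h).trans (by linarith [norm_nonneg Y])
    · have := hM₁ Y hY ((le_max_left _ _).trans (not_le.1 h).le)
      linarith
  set C : ℝ := C₀ + 1 + |κ| with hCdef
  have hCpos : 0 < C := by rw [hCdef]; positivity
  have hgrowth : ∀ Y : ℝ × ℝ, Y.1 ≤ 0 → |Φ Y| ≤ C * (1 + ‖Y‖ ^ 2) := by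
    intro Y hY
    set SY : Set (ℝ × ℝ) := {q : ℝ × ℝ | q.1 ≤ 0} ∩ Metric.closedBall (0 : ℝ × ℝ) ‖Y‖ with hSY
    have hconv : Convex ℝ SY :=
      (convex_halfSpace_le (LinearMap.fst ℝ ℝ ℝ).isLinear 0).inter (convex_closedBall _ _)
    have h0S : (0 : ℝ × ℝ) ∈ SY :=
      ⟨show (0 : ℝ × ℝ).1 ≤ 0 by simp, Metric.mem_closedBall_self (norm_nonneg Y)⟩
    have hYS : Y ∈ SY := ⟨hY, mem_closedBall_zero_iff.2 le_rfl⟩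
    have hdiffS : ∀ q ∈ SY, DifferentiableAt ℝ Φ q := fun q hq =>
      differentiableAt_of_contDiffOn_open hΦ hO two_ne_zero (hHO hq.1)
    have hbound : ∀ q ∈ SY, ‖fderiv ℝ Φ q‖ ≤ C₀ + (1 + |κ|) * ‖Y‖ := by
      intro q hq
      have hq2 : ‖q‖ ≤ ‖Y‖ := mem_closedBall_zero_iff.1 hq.2
      have hq1 : |q.1| ≤ ‖q‖ := norm_fst_le q
      refine (opNorm_fderiv_le Φ q).trans ?_
      rw [hΦR q (hHO hq.1), hΦZ q (hHO hq.1)]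
      have h1 := hgradall q hq.1
      have h2 : |derivR Ψ q - κ * q.1| ≤ |derivR Ψ q| + |κ| * |q.1| := by
        calc |derivR Ψ q - κ * q.1| ≤ |derivR Ψ q| + |κ * q.1| := abs_sub _ _
          _ = |derivR Ψ q| + |κ| * |q.1| := by rw [abs_mul]
      have h3 : |κ| * |q.1| ≤ |κ| * ‖Y‖ := mul_le_mul_of_nonneg_left (hq1.trans hq2) (abs_nonneg κ)
      nlinarith [abs_nonneg (derivZ Ψ q)]
    have hmv := hconv.norm_image_sub_le_of_norm_fderiv_le hdiffS hbound h0S hYS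
    have hΦ00 : Φ 0 = 0 := hΦ0 0
    rw [hΦ00, sub_zero, sub_zero, Real.norm_eq_abs] at hmv
    have hn := norm_nonneg Y
    have : ‖Y‖ ≤ 1 + ‖Y‖ ^ 2 := by nlinarith [sq_nonneg (‖Y‖ - 1)]
    calc |Φ Y| ≤ (C₀ + (1 + |κ|) * ‖Y‖) * ‖Y‖ := hmv
      _ ≤ C * (1 + ‖Y‖ ^ 2) := by rw [hCdef]; nlinarith [abs_nonneg κ]
  -- S5: odd reflection, harmonic on `ℂ`, quadratic growth there
  obtain ⟨hgC2, hgΔ⟩ := oddReflection_C2_harmonic hO hHO hΦ hΦ0 hΔ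
  set g : ℝ × ℝ → ℝ := fun Y => if Y.1 ≤ 0 then Φ Y else -Φ (-Y.1, Y.2) with hgdef
  have hharm := harmonicOnNhd_of_laplace hgC2 hgΔ
  have hfgrowth : ∀ z : ℂ, |g (z.re, z.im)| ≤ C * (1 + ‖z‖ ^ 2) := by
    intro z
    have hre : |z.re| ≤ ‖z‖ := Complex.abs_re_le_norm z
    have him : |z.im| ≤ ‖z‖ := Complex.abs_im_le_norm z
    by_cases h : z.re ≤ 0
    · have hn : ‖((z.re, z.im) : ℝ × ℝ)‖ ≤ ‖z‖ := by
        rw [Prod.norm_def]; exact max_le hre him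
      simp only [hgdef, h, if_true]
      refine (hgrowth _ h).trans ?_
      gcongr
    · have hn : ‖((-z.re, z.im) : ℝ × ℝ)‖ ≤ ‖z‖ := by
        rw [Prod.norm_def]; refine max_le ?_ him; simpa using hre
      simp only [hgdef, h, if_false, abs_neg]
      refine (hgrowth _ (by simp only; linarith [not_le.1 h])).trans ?_
      gcongr
  -- S6: the harmonic quadratic polynomial and the wall condition
  obtain ⟨α, β', c, hrep⟩ := harmonic_quadratic_growth hharm hCpos hfgrowth
  have hΦrep : ∀ Y : ℝ × ℝ, Y.1 ≤ 0 → Φ Y = α.re * (Y.1 ^ 2 - Y.2 ^ 2)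
      - 2 * α.im * Y.1 * Y.2 + β'.re * Y.1 - β'.im * Y.2 + c.re := by
    intro Y hY
    have h := hrep ⟨Y.1, Y.2⟩
    simp only [hgdef, hY, if_true] at h
    rw [show ((⟨Y.1, Y.2⟩ : ℂ).re, (⟨Y.1, Y.2⟩ : ℂ).im) = Y from rfl] at h
    rw [h]
    simp [Complex.add_re, Complex.mul_re, Complex.mul_im, sq]
    ring
  have hc : c.re = 0 := by
    have := hΦrep (0, 0) le_rfl; rw [hΦ0] at this; simp at this; linarith
  have hab : α.re = 0 ∧ β'.im = 0 := by
    have h1 := hΦrep (0, 1) le_rfl; rw [hΦ0] at h1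
    have h2 := hΦrep (0, -1) le_rfl; rw [hΦ0] at h2
    simp only at h1 h2
    constructor <;> nlinarith
  -- so `Ψ` is an explicit quadratic on the closed half-plane
  set A : ℝ := -2 * α.im with hA
  set B : ℝ := β'.re with hB
  have hΨrep : ∀ Y : ℝ × ℝ, Y.1 ≤ 0 → Ψ Y = A * Y.1 * Y.2 + B * Y.1 + β + κ / 2 * Y.1 ^ 2 := by
    intro Y hY
    have h := hΦrep Y hY
    rw [hab.1, hab.2, hc] at h
    have : Ψ Y = Φ Y - ((0 : ℝ) * Y.1 * Y.2 + 0 * Y.1 + (-β) + (-κ) / 2 * Y.1 ^ 2) := by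
      simp only [hΦdef]; ring
    rw [this, h, hA, hB]; ring
  -- S7: partials of `Ψ` on the open half-plane
  have hopen_lt : IsOpen {q : ℝ × ℝ | q.1 < 0} := isOpen_lt continuous_fst continuous_const
  have hderivs : ∀ Y : ℝ × ℝ, Y.1 < 0 →
      derivR Ψ Y = A * Y.2 + B + κ * Y.1 ∧ derivZ Ψ Y = A * Y.1 := by
    intro Y hY
    have hev : Ψ =ᶠ[𝓝 Y] fun q : ℝ × ℝ => A * q.1 * q.2 + B * q.1 + β + κ / 2 * q.1 ^ 2 := by
      filter_upwards [hopen_lt.mem_nhds hY] with q hq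
      exact hΨrep q hq.le
    have d := derivs_explicit A B β κ Y
    exact ⟨by rw [derivR_congr_nhds hev, d.1], by rw [derivZ_congr_nhds hev, d.2.1]⟩
  -- S8: the growth condition forces `A = 0` and `κ = 0`
  have hnormpt : ∀ r : ℝ, 0 < r → ‖((-r, 0) : ℝ × ℝ)‖ = r := fun r hr => by
    rw [Prod.norm_def]
    simp only [Real.norm_eq_abs, abs_neg, abs_zero, abs_of_pos hr]
    exact max_eq_left hr.le
  have hA0 : A = 0 := by
    have hle : ∀ ε : ℝ, 0 < ε → |A| ≤ ε := by
      intro ε hε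
      obtain ⟨M, hM⟩ := hgrad ε hε
      set r : ℝ := max M 1 with hr
      have hrpos : 0 < r := lt_of_lt_of_le one_pos (le_max_right _ _)
      have hpt := hM (-r, 0) (by simp only; linarith) (by rw [hnormpt r hrpos]; exact le_max_left _ _)
      rw [hnormpt r hrpos, (hderivs (-r, 0) (by simp only; linarith)).2] at hpt
      simp only at hpt
      have h1 : |A * -r| = |A| * r := by rw [abs_mul, abs_neg, abs_of_pos hrpos]
      rw [h1] at hpt
      have h2 : |A| * r ≤ ε * r := le_trans (by linarith [abs_nonneg (derivR Ψ (-r, 0))]) hpt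
      exact le_of_mul_le_mul_right h2 hrpos
    have : |A| ≤ 0 := le_of_forall_pos_le_add fun ε hε => by linarith [hle ε hε]
    exact abs_eq_zero.1 (le_antisymm this (abs_nonneg A))
  have hκ0 : κ = 0 := by
    have hle : ∀ ε : ℝ, 0 < ε → |κ| ≤ 2 * ε := by
      intro ε hε
      obtain ⟨M, hM⟩ := hgrad ε hε
      set r : ℝ := max (max M 1) (|B| / ε) with hr
      have hrpos : 0 < r := lt_of_lt_of_le one_pos ((le_max_right _ _).trans (le_max_left _ _))
      have hrM : M ≤ r := (le_max_left _ _).trans (le_max_left _ _)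
      have hrB : |B| ≤ ε * r := by
        have : |B| / ε ≤ r := le_max_right _ _
        rwa [div_le_iff₀ hε, mul_comm] at this
      have hpt := hM (-r, 0) (by simp only; linarith) (by rw [hnormpt r hrpos]; exact hrM)
      rw [hnormpt r hrpos, (hderivs (-r, 0) (by simp only; linarith)).1, hA0] at hpt
      simp only [zero_mul, zero_add] at hpt
      have h1 : |κ| * r ≤ |B + κ * -r| + |B| := by
        have : |κ * -r| = |κ| * r := by rw [abs_mul, abs_neg, abs_of_pos hrpos]
        rw [← this]
        have := abs_sub (κ * -r + B) B
        simp only [add_sub_cancel_right] at this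
        linarith [abs_sub_abs_le_abs_sub (κ * -r) (-(B)), abs_add_le (B + κ * -r) (-B),
          show |κ * -r| ≤ |B + κ * -r| + |B| from by
            calc |κ * -r| = |(B + κ * -r) + (-B)| := by ring_nf
              _ ≤ |B + κ * -r| + |-B| := abs_add_le _ _
              _ = |B + κ * -r| + |B| := by rw [abs_neg]]
      have h2 : |B + κ * -r| ≤ ε * r := le_trans (by linarith [abs_nonneg (derivZ Ψ (-r, 0))]) hpt
      have h3 : |κ| * r ≤ 2 * ε * r := by linarith
      exact le_of_mul_le_mul_right h3 hrpos
    have : |κ| ≤ 0 := le_of_forall_pos_le_add fun ε hε => by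
      have := hle (ε / 2) (half_pos hε); linarith
    exact abs_eq_zero.1 (le_antisymm this (abs_nonneg κ))
  -- S9: conclusion
  refine ⟨hκ0, B, β, fun Y hY => ⟨?_, ?_⟩⟩
  · rw [hΨrep Y hY, hA0, hκ0]; ring
  · have hop : ∀ Y' : ℝ × ℝ, Y'.1 < 0 → derivR Ψ Y' = B ∧ derivZ Ψ Y' = 0 := by
      intro Y' hY'
      have d := hderivs Y' hY'
      rw [hA0, hκ0] at d
      exact ⟨by rw [d.1]; ring, by rw [d.2]; ring⟩
    rcases hY.lt_or_eq with hlt | heq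
    · exact hop Y hlt
    · have eY : Y = (0, Y.2) := by ext <;> simp [heq]
      rw [eY]
      exact ⟨eq_at_wall_of_eq_on_open
          ((continuousOn_derivR_open (hΨ.of_le one_le_two) hO).continuousAt
            (hO.mem_nhds (wallO _))) fun Y' h => (hop Y' h).1,
        eq_at_wall_of_eq_on_open
          ((continuousOn_derivZ_open (hΨ.of_le one_le_two) hO).continuousAt
            (hO.mem_nhds (wallO _))) fun Y' h => (hop Y' h).2⟩

end Stream

/-! ### Engine A: the maximum principle on the closed half-plane and the ray argument -/

section MaxPrinciple

variable {O : Set (ℝ × ℝ)}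

/-- The transport expression extends by continuity from the open half-plane to the wall.
[folklore] -/
private theorem transport_eq_wall (hO : IsOpen O) (hHO : {Y : ℝ × ℝ | Y.1 ≤ 0} ⊆ O)
    {U W₁ W₂ : ℝ × ℝ → ℝ} {c γ : ℝ} (hU : ContDiffOn ℝ 1 U O)
    (hW₁ : ContinuousOn W₁ O) (hW₂ : ContinuousOn W₂ O)
    (heq : ∀ Y : ℝ × ℝ, Y.1 < 0 → c * U Y + γ * (Y.1 * derivR U Y + Y.2 * derivZ U Y) +
      (W₁ Y * derivR U Y + W₂ Y * derivZ U Y) = 0) {Y : ℝ × ℝ} (hY : Y.1 ≤ 0) :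
    c * U Y + γ * (Y.1 * derivR U Y + Y.2 * derivZ U Y) +
      (W₁ Y * derivR U Y + W₂ Y * derivZ U Y) = 0 := by
  rcases hY.lt_or_eq with hlt | heq0
  · exact heq Y hlt
  · have eY : Y = (0, Y.2) := by ext <;> simp [heq0]
    have hYO : ((0 : ℝ), Y.2) ∈ O := hHO (show ((0 : ℝ), Y.2).1 ≤ 0 from le_rfl)
    have hn : O ∈ 𝓝 ((0 : ℝ), Y.2) := hO.mem_nhds hYO
    have cU : ContinuousAt U (0, Y.2) := (hU.continuousOn.continuousAt hn)
    have cR : ContinuousAt (derivR U) (0, Y.2) := (continuousOn_derivR_open hU hO).continuousAt hn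
    have cZ : ContinuousAt (derivZ U) (0, Y.2) := (continuousOn_derivZ_open hU hO).continuousAt hn
    have c1 : ContinuousAt W₁ (0, Y.2) := hW₁.continuousAt hn
    have c2 : ContinuousAt W₂ (0, Y.2) := hW₂.continuousAt hn
    have cfst : ContinuousAt (fun q : ℝ × ℝ => q.1) (0, Y.2) := continuous_fst.continuousAt
    have csnd : ContinuousAt (fun q : ℝ × ℝ => q.2) (0, Y.2) := continuous_snd.continuousAt
    have hc : ContinuousAt (fun q : ℝ × ℝ => c * U q + γ * (q.1 * derivR U q + q.2 * derivZ U q) +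
        (W₁ q * derivR U q + W₂ q * derivZ U q)) (0, Y.2) :=
      ((continuousAt_const.mul cU).add (continuousAt_const.mul ((cfst.mul cR).add
        (csnd.mul cZ)))).add ((c1.mul cR).add (c2.mul cZ))
    rw [eY]
    exact eq_at_wall_of_eq_on_open hc heq

/-- No positive maximum: auxiliary half of the maximum principle. [folklore] -/
private theorem no_pos_of_transport (hO : IsOpen O) (hHO : {Y : ℝ × ℝ | Y.1 ≤ 0} ⊆ O)
    {U W₁ W₂ : ℝ × ℝ → ℝ} {c γ : ℝ} (hc : c ≠ 0) (hU : ContDiffOn ℝ 1 U O)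
    (hW₁ : ContinuousOn W₁ O) (hW₂ : ContinuousOn W₂ O) (hW₁wall : ∀ Z : ℝ, W₁ (0, Z) = 0)
    (heq : ∀ Y : ℝ × ℝ, Y.1 < 0 → c * U Y + γ * (Y.1 * derivR U Y + Y.2 * derivZ U Y) +
      (W₁ Y * derivR U Y + W₂ Y * derivZ U Y) = 0)
    (hdecay : ∀ ε : ℝ, 0 < ε → ∃ M : ℝ, ∀ Y : ℝ × ℝ, Y.1 ≤ 0 → M ≤ ‖Y‖ → |U Y| < ε)
    {Y₁ : ℝ × ℝ} (hY₁ : Y₁.1 ≤ 0) : U Y₁ ≤ 0 := by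
  by_contra hpos
  rw [not_le] at hpos
  have heq' := fun Y hY => transport_eq_wall hO hHO hU hW₁ hW₂ heq (Y := Y) hY
  obtain ⟨M, hM⟩ := hdecay (U Y₁) hpos
  set ρ : ℝ := max M ‖Y₁‖ with hρ
  set K : Set (ℝ × ℝ) := {Y : ℝ × ℝ | Y.1 ≤ 0} ∩ Metric.closedBall 0 ρ with hK
  have hKc : IsCompact K :=
    (isCompact_closedBall _ _).inter_left (isClosed_le continuous_fst continuous_const)
  have hY₁K : Y₁ ∈ K := ⟨hY₁, mem_closedBall_zero_iff.2 (le_max_right _ _)⟩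
  have hUc : ContinuousOn U K := hU.continuousOn.mono fun Y hY => hHO hY.1
  obtain ⟨Y₀, hY₀K, hmax⟩ := hKc.exists_isMaxOn ⟨Y₁, hY₁K⟩ hUc
  have hY₀ : Y₀.1 ≤ 0 := hY₀K.1
  have hge : U Y₁ ≤ U Y₀ := hmax hY₁K
  -- `Y₀` is a maximum of `U` over the whole closed half-plane
  have hall : ∀ Y : ℝ × ℝ, Y.1 ≤ 0 → U Y ≤ U Y₀ := by
    intro Y hY
    by_cases h : ‖Y‖ ≤ ρ
    · exact hmax ⟨hY, mem_closedBall_zero_iff.2 h⟩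
    · have := hM Y hY ((le_max_left _ _).trans (not_le.1 h).le)
      have := (abs_lt.1 this).2
      linarith
  have hUY₀ : 0 < U Y₀ := lt_of_lt_of_le hpos hge
  rcases hY₀.lt_or_eq with hlt | hwall
  · -- interior maximum: the gradient vanishes
    have hloc : IsLocalMax U Y₀ := by
      have ho : IsOpen {q : ℝ × ℝ | q.1 < 0} := isOpen_lt continuous_fst continuous_const
      filter_upwards [ho.mem_nhds hlt] with q hq
      exact hall q hq.le
    have hfd : fderiv ℝ U Y₀ = 0 := hloc.fderiv_eq_zero
    have hR : derivR U Y₀ = 0 := by rw [derivR_apply, hfd]; rfl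
    have hZ : derivZ U Y₀ = 0 := by rw [derivZ_apply, hfd]; rfl
    have := heq' Y₀ hY₀
    rw [hR, hZ] at this
    have : c * U Y₀ = 0 := by linarith
    rcases mul_eq_zero.1 this with h | h
    · exact hc h
    · linarith
  · -- boundary maximum: the tangential derivative vanishes, the wall condition kills `∂_R`
    have eY : Y₀ = (0, Y₀.2) := by ext <;> simp [hwall]
    have hY₀O : Y₀ ∈ O := hHO hY₀
    have hslice : HasDerivAt (fun z : ℝ => U (Y₀.1, z)) (derivZ U Y₀) Y₀.2 :=
      hasDerivAt_sliceZ_pt (differentiableAt_of_contDiffOn_open hU hO one_ne_zero hY₀O)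
    have hloc : IsLocalMax (fun z : ℝ => U (Y₀.1, z)) Y₀.2 :=
      Filter.Eventually.of_forall fun z => hall (Y₀.1, z) hY₀
    have hZ : derivZ U Y₀ = 0 := by
      have := hloc.deriv_eq_zero
      rwa [hslice.deriv] at this
    have := heq' Y₀ hY₀
    rw [hZ, hwall, eY, hW₁wall] at this
    simp only [zero_mul, mul_zero, add_zero] at this
    rw [← eY] at this
    rcases mul_eq_zero.1 this with h | h
    · exact hc h
    · linarith

/-- **Engine A (maximum principle on the closed half-plane; Chae–Tsai's `U₀`-argument).**
A `C¹` function `U` on an open neighbourhood of `𝒟̄ = {R ≤ 0}`, decaying at infinity in `𝒟̄`,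
that solves `cU + γY·∇U + W·∇U = 0` on the open half-plane with `c ≠ 0` and a continuous
field `W` whose normal component `W₁` vanishes on the wall, is identically zero on `𝒟̄`: at an
interior extremum `∇U = 0`; at a wall extremum the tangential derivative vanishes and
`R∂_R U`, `W₁∂_R U` vanish because `R = W₁ = 0` there.
[cite: ChaeTsai2015, §3, proof of Thm. 2 (arXiv p. 5): "Suppose sup U₀ > 0 … Thus Y₀ lies on the Z-axis … We get (1 − γ/2)U₀(Y₀) = 0"] -/
theorem eq_zero_of_transport_wall_maxPrinciple (hO : IsOpen O)
    (hHO : {Y : ℝ × ℝ | Y.1 ≤ 0} ⊆ O) {U W₁ W₂ : ℝ × ℝ → ℝ} {c γ : ℝ} (hc : c ≠ 0)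
    (hU : ContDiffOn ℝ 1 U O) (hW₁ : ContinuousOn W₁ O) (hW₂ : ContinuousOn W₂ O)
    (hW₁wall : ∀ Z : ℝ, W₁ (0, Z) = 0)
    (heq : ∀ Y : ℝ × ℝ, Y.1 < 0 → c * U Y + γ * (Y.1 * derivR U Y + Y.2 * derivZ U Y) +
      (W₁ Y * derivR U Y + W₂ Y * derivZ U Y) = 0)
    (hdecay : ∀ ε : ℝ, 0 < ε → ∃ M : ℝ, ∀ Y : ℝ × ℝ, Y.1 ≤ 0 → M ≤ ‖Y‖ → |U Y| < ε) :
    ∀ Y : ℝ × ℝ, Y.1 ≤ 0 → U Y = 0 := by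
  intro Y hY
  have h1 : U Y ≤ 0 := no_pos_of_transport hO hHO hc hU hW₁ hW₂ hW₁wall heq hdecay hY
  -- the same for `−U`
  have hU' : ContDiffOn ℝ 1 (fun q => -U q) O := hU.neg
  have heq' : ∀ Y : ℝ × ℝ, Y.1 < 0 → c * (-U Y) + γ * (Y.1 * derivR (fun q => -U q) Y +
      Y.2 * derivZ (fun q => -U q) Y) + (W₁ Y * derivR (fun q => -U q) Y +
      W₂ Y * derivZ (fun q => -U q) Y) = 0 := by
    intro Y' hY'
    rw [derivR_fun_neg, derivZ_fun_neg]
    linear_combination -(heq Y' hY')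
  have hdecay' : ∀ ε : ℝ, 0 < ε → ∃ M : ℝ, ∀ Y : ℝ × ℝ, Y.1 ≤ 0 → M ≤ ‖Y‖ → |(-U Y)| < ε := by
    intro ε hε
    obtain ⟨M, hM⟩ := hdecay ε hε
    exact ⟨M, fun Y hY hM' => by rw [abs_neg]; exact hM Y hY hM'⟩
  have h2 : -U Y ≤ 0 := no_pos_of_transport hO hHO hc hU' hW₁ hW₂ hW₁wall heq' hdecay' hY
  linarith

/-- **Engine A′ (the resonant orders: transport along rays from a wall point).** A `C¹`
function on an open neighbourhood of `𝒟̄`, decaying at infinity in `𝒟̄`, with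
`R ∂_R U + (Z − z₀) ∂_Z U = 0` on the open half-plane, vanishes on `𝒟̄`: it is constant along
every ray issuing from the wall point `(0, z₀)`, and such rays stay in `𝒟̄` and escape to
infinity. (Replaces print's cut-off/`L^p` argument at the resonant orders `k ≥ 1`, where the
transport field is `γ(Y − Y_*)` because the lower-order stream profile is affine.)
[cite: ChaeTsai2015, §3, proof of Thm. 2 (arXiv p. 5–6), case `1 − γ/2 − kγ = 0` / `1 − kγ = 0`; cf. §2 proof of Thm. 1, case γ = 2 ("U(Z) = constant = 0 for Z ≠ 0. By continuity …")] -/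
theorem eq_zero_of_rayTransport (hO : IsOpen O) (hHO : {Y : ℝ × ℝ | Y.1 ≤ 0} ⊆ O)
    {U : ℝ × ℝ → ℝ} {z₀ : ℝ} (hU : ContDiffOn ℝ 1 U O)
    (heq : ∀ Y : ℝ × ℝ, Y.1 < 0 → Y.1 * derivR U Y + (Y.2 - z₀) * derivZ U Y = 0)
    (hdecay : ∀ ε : ℝ, 0 < ε → ∃ M : ℝ, ∀ Y : ℝ × ℝ, Y.1 ≤ 0 → M ≤ ‖Y‖ → |U Y| < ε) :
    ∀ Y : ℝ × ℝ, Y.1 ≤ 0 → U Y = 0 := by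
  -- the equation in `Engine A` form with `c = 0` is not available, so extend by hand
  have heq' : ∀ Y : ℝ × ℝ, Y.1 ≤ 0 → Y.1 * derivR U Y + (Y.2 - z₀) * derivZ U Y = 0 := by
    intro Y hY
    have h := transport_eq_wall hO hHO (c := 0) (γ := 1) (W₁ := fun _ => 0) (W₂ := fun _ => -z₀)
      hU continuousOn_const continuousOn_const (fun Y' hY' => by
        simp only [zero_mul, one_mul, zero_add]; linear_combination heq Y' hY') hY
    simp only [zero_mul, one_mul, zero_add] at h
    linear_combination h
  -- points off the vertex: constant along the ray, which escapes to infinity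
  have hoff : ∀ Y : ℝ × ℝ, Y.1 ≤ 0 → Y ≠ (0, z₀) → U Y = 0 := by
    intro Y hY hne
    set V : ℝ × ℝ := Y - (0, z₀) with hV
    have hV0 : V ≠ 0 := sub_ne_zero.2 hne
    have hVn : 0 < ‖V‖ := norm_pos_iff.2 hV0
    set ℓ : ℝ → ℝ × ℝ := fun l => (0, z₀) + l • V with hℓ
    have hℓ1 : ∀ l : ℝ, (ℓ l).1 = l * Y.1 := fun l => by simp [hℓ, hV]
    have hℓ2 : ∀ l : ℝ, (ℓ l).2 - z₀ = l * (Y.2 - z₀) := fun l => by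
      simp only [hℓ, hV, Prod.snd_add, Prod.smul_snd, Prod.snd_sub, smul_eq_mul]; ring
    have hℓmem : ∀ l : ℝ, 0 < l → (ℓ l).1 ≤ 0 := fun l hl => by
      rw [hℓ1]; exact mul_nonpos_of_nonneg_of_nonpos hl.le hY
    have hℓderiv : ∀ l : ℝ, HasDerivAt ℓ V l := fun l => by
      have := ((hasDerivAt_id' l).smul_const V).const_add ((0 : ℝ), z₀)
      simpa [hℓ] using this
    set φ : ℝ → ℝ := fun l => U (ℓ l) with hφ
    have hφderiv : ∀ l : ℝ, 0 < l → HasDerivAt φ 0 l := by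
      intro l hl
      have hd : DifferentiableAt ℝ U (ℓ l) :=
        differentiableAt_of_contDiffOn_open hU hO one_ne_zero (hHO (hℓmem l hl))
      have h := hd.hasFDerivAt.comp_hasDerivAt l (hℓderiv l)
      have hval : fderiv ℝ U (ℓ l) V = 0 := by
        rw [show V = (V.1, V.2) from rfl, fderiv_apply_eq_derivR_derivZ]
        have e := heq' (ℓ l) (hℓmem l hl)
        rw [hℓ1, hℓ2] at e
        have hV1 : V.1 = Y.1 := by simp [hV]
        have hV2 : V.2 = Y.2 - z₀ := by simp [hV]
        rw [hV1, hV2]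
        have : l * (Y.1 * derivR U (ℓ l) + (Y.2 - z₀) * derivZ U (ℓ l)) = 0 := by
          linear_combination e
        rcases mul_eq_zero.1 this with h0 | h0
        · exact absurd h0 hl.ne'
        · exact h0
      rw [hval] at h
      exact h
    have hconst : ∀ l : ℝ, 0 < l → φ l = φ 1 := by
      intro l hl
      refine isOpen_Ioi.is_const_of_deriv_eq_zero isPreconnected_Ioi
        (fun x hx => (hφderiv x hx).differentiableAt.differentiableWithinAt)
        (fun x hx => (hφderiv x hx).deriv) hl (mem_Ioi.2 one_pos)
    have hφ1 : φ 1 = U Y := by simp [hφ, hℓ, hV]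
    by_contra hne0
    have hε : 0 < |U Y| := abs_pos.2 hne0
    obtain ⟨M, hM⟩ := hdecay _ hε
    -- a point far out on the ray
    set l : ℝ := max 1 ((|M| + ‖((0 : ℝ), z₀)‖) / ‖V‖ + 1) with hl
    have hlpos : 0 < l := lt_of_lt_of_le one_pos (le_max_left _ _)
    have hlV : |M| + ‖((0 : ℝ), z₀)‖ ≤ l * ‖V‖ := by
      have h1 : (|M| + ‖((0 : ℝ), z₀)‖) / ‖V‖ + 1 ≤ l := le_max_right _ _
      have h2 : (|M| + ‖((0 : ℝ), z₀)‖) / ‖V‖ * ‖V‖ = |M| + ‖((0 : ℝ), z₀)‖ :=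
        div_mul_cancel₀ _ hVn.ne'
      nlinarith
    have hnorm : M ≤ ‖ℓ l‖ := by
      have : ‖l • V‖ ≤ ‖ℓ l‖ + ‖((0 : ℝ), z₀)‖ := by
        have := norm_sub_le (ℓ l) ((0 : ℝ), z₀)
        simpa [hℓ] using this
      rw [norm_smul, Real.norm_eq_abs, abs_of_pos hlpos] at this
      linarith [le_abs_self M]
    have hlt := hM (ℓ l) (hℓmem l hlpos) hnorm
    have : U (ℓ l) = U Y := by rw [← hφ1, ← hconst l hlpos]
    rw [this] at hlt
    exact lt_irrefl _ hlt
  intro Y hY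
  by_cases hne : Y = (0, z₀)
  · rw [hne]
    have hc : ContinuousAt U (0, z₀) :=
      hU.continuousOn.continuousAt (hO.mem_nhds (hHO (show ((0 : ℝ), z₀).1 ≤ 0 from le_rfl)))
    exact eq_at_wall_of_eq_on_open hc fun Y' hY' => hoff Y' hY'.le fun e => by
      rw [e] at hY'; simp at hY'
  · exact hoff Y hY hne

end MaxPrinciple

end LuoHouSeries

end Literature.Analysis.FluidPDE

end
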